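import Literature.AlgebraicGeometry.Resolution.ArithmeticalThreefoldsLocalPolyhedron
import Literature.AlgebraicGeometry.Resolution.RsopMonomialIdeals
import Mathlib.Order.WellQuasiOrder
import Mathlib.Order.WellFoundedSet
import Mathlib.RingTheory.Filtration
import Mathlib.Algebra.Order.BigOperators.Group.Finset
import Mathlib.RingTheory.Localization.AtPrime.Basic
import Mathlib.Algebra.Polynomial.Eval.Degree
import Mathlib.RingTheory.Flat.FaithfullyFlat.Basic
import Mathlib.RingTheory.AdicCompletion.LocalRing
import Mathlib.RingTheory.AdicCompletion.AsTensorProduct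
import HarnessLib

/-!
# Monomial ideals in (part of) a regular system of parameters (Cossart–Piltant 2019, Prop. 2.1)

Topic: `Literature/AlgebraicGeometry/Resolution`. PROOF-side foundations for Ch. 2 of

* V. Cossart, O. Piltant, *Resolution of singularities of arithmetical threefolds*, J. Algebra
  529 (2019) 268–535 = arXiv:1412.0868 (v1), Prop. 2.1 (v1 p. 10) and the monomial valuations
  `μ_α` of v1 p. 9,

in support of the named fact `CossartPiltant2019Local` (`ArithmeticalThreefoldsLocal.lean`) and
of the definitions of `ArithmeticalThreefoldsLocalPolyhedron.lean` (`uPow`, `monomialIdeal`,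
`monomialVal`). Everything is PROVED; no definitions and no named facts are introduced.

For a family `u : Fin N → S` in a commutative ring we use the hypothesis

  (H) `∀ i T, i ∉ T → (u i · y ∈ (u_t : t ∈ T) → y ∈ (u_t : t ∈ T))`,

i.e. each `u_i` is a non-zero-divisor modulo the ideal generated by any sub-family not containing
it. (H) holds for (part of) a regular system of parameters of a regular local ring
(`hypH_of_rsop`, `IsRsopPart.hypH`; Matsumura Thms. 14.2–14.3, 17.8, as formalized in
`RegularSystemOfParameters.lean`). Under (H) the ideals `(u^b : b ∈ B)` generated by monomials
behave as in a polynomial ring: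

* `mem_of_mul_mem_sup_span_uPow` — `u_i` is a non-zero-divisor modulo `(u_T) + (u^b : b ∈ B)`
  whenever `i ∉ T` and no `b ∈ B` involves the variable `i` (double induction on the exponent
  mass outside `T`);
* `mem_span_uPow_lower_of_mul_mem` / `mul_mem_span_uPow_iff` — the colon formula
  `((u^b : b ∈ B) : u_j) = (u^{b ∸ e_j} : b ∈ B)`;
* `uPow_mem_span_uPow_iff` — **`u^a ∈ (u^b : b ∈ B) ⟺ ∃ b ∈ B, b ≤ a`** (all `u_i` non-units);
* `span_uPow_inf_span_uPow` — **`(u^b : b ∈ B) ∩ (u^c : c ∈ C) = (u^{b ⊔ c} : b ∈ B, c ∈ C)`**;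
* `exists_minimal_span_uPow` — **Cossart–Piltant 2019, Prop. 2.1** for a Noetherian local `S`:
  every `f ∈ S` lies in a smallest monomial ideal `I(f) = (u^a : a ∈ 𝐒(f))`, `𝐒(f)` a finite
  antichain of `ℕ^N`, unique (`antichain_unique_of_minimal`), and in any expansion
  `f = ∑_{a ∈ 𝐒(f)} γ_a u^a` the coefficients satisfy `γ_a ∉ (u)` (`coeff_not_mem_of_minimal`);
  conversely an expansion over an antichain with coefficients `∉ (u)` computes `𝐒(f)`
  (`minimal_of_coeff_not_mem`).

## Sources

* V. Cossart, O. Piltant, J. Algebra 529 (2019) = arXiv:1412.0868, Ch. 2, Prop. 2.1 (v1 p. 10).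
  [CossartPiltant2019]
* H. Matsumura, *Commutative Ring Theory*, CUP 1986, Thms. 14.2, 14.3, 17.8 (regular systems of
  parameters generate prime ideals / are `A`-sequences). [Matsumura1987]
-/

open Finset IsLocalRing

namespace Literature.AlgebraicGeometry.Resolution.CossartPiltant

universe u

variable {S : Type u} [CommRing S] {N : ℕ}

/-! ## Monomial arithmetic -/

/-- `a ≤ b ⇒ u^a ∣ u^b`. [folklore] -/
theorem uPow_dvd_uPow_of_le (u : Fin N → S) {a b : Fin N → ℕ} (h : a ≤ b) :
    uPow u a ∣ uPow u b := by
  refine ⟨uPow u (b - a), ?_⟩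
  rw [← uPow_add]
  congr 1
  funext j
  exact (Nat.add_sub_cancel' (h j)).symm

/-- `u_j · u^{b - e_j} = u^b` when `b_j > 0`. [folklore] -/
theorem mul_uPow_sub_single (u : Fin N → S) {b : Fin N → ℕ} {j : Fin N} (h : 0 < b j) :
    u j * uPow u (b - Pi.single j 1) = uPow u b := by
  rw [← uPow_single u j, ← uPow_add]
  congr 1
  funext l
  by_cases hl : l = j
  · subst hl
    simp only [Pi.add_apply, Pi.sub_apply, Pi.single_eq_same]
    omega
  · simp [hl]

/-- `b_j > 0 ⇒ u_j ∣ u^b`. [folklore] -/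
theorem dvd_uPow_of_pos (u : Fin N → S) {b : Fin N → ℕ} {j : Fin N} (h : 0 < b j) :
    u j ∣ uPow u b :=
  ⟨uPow u (b - Pi.single j 1), (mul_uPow_sub_single u h).symm⟩

/-- A monomial `u^b`, `b ∈ B`, lies in `(u^b : b ∈ B)`. [folklore] -/
theorem uPow_mem_span_uPow (u : Fin N → S) {B : Set (Fin N → ℕ)} {b : Fin N → ℕ} (hb : b ∈ B) :
    uPow u b ∈ Ideal.span (uPow u '' B) :=
  Ideal.subset_span ⟨b, hb, rfl⟩

/-- `b ∈ B`, `b ≤ a ⇒ u^a ∈ (u^b : b ∈ B)`. [folklore] -/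
theorem uPow_mem_span_uPow_of_le (u : Fin N → S) {B : Set (Fin N → ℕ)} {a b : Fin N → ℕ}
    (hb : b ∈ B) (h : b ≤ a) : uPow u a ∈ Ideal.span (uPow u '' B) := by
  obtain ⟨c, hc⟩ := uPow_dvd_uPow_of_le u h
  rw [hc]
  exact Ideal.mul_mem_right _ _ (uPow_mem_span_uPow u hb)

/-- `(u^b : b ∈ B) ⊆ I` iff every `u^b ∈ I`. [folklore] -/
theorem span_uPow_le_iff (u : Fin N → S) {B : Set (Fin N → ℕ)} {I : Ideal S} :
    Ideal.span (uPow u '' B) ≤ I ↔ ∀ b ∈ B, uPow u b ∈ I := by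
  rw [Ideal.span_le, Set.image_subset_iff]
  rfl

/-- Monotonicity of monomial ideals in the "upper set" sense: if every `c ∈ C` lies above some
`b ∈ B` then `(u^c : c ∈ C) ⊆ (u^b : b ∈ B)`. [folklore] -/
theorem span_uPow_mono_of_forall_exists_le (u : Fin N → S) {B C : Set (Fin N → ℕ)}
    (h : ∀ c ∈ C, ∃ b ∈ B, b ≤ c) : Ideal.span (uPow u '' C) ≤ Ideal.span (uPow u '' B) := by
  rw [span_uPow_le_iff]
  intro c hc
  obtain ⟨b, hb, hbc⟩ := h c hc
  exact uPow_mem_span_uPow_of_le u hb hbc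

/-- Multiplication into a sum of two spans, generator by generator. [folklore] -/
theorem mul_mem_of_forall_mem_sup_span {x : S} {s t : Set S} {I : Ideal S}
    (hs : ∀ g ∈ s, x * g ∈ I) (ht : ∀ g ∈ t, x * g ∈ I) {y : S}
    (hy : y ∈ Ideal.span s ⊔ Ideal.span t) : x * y ∈ I := by
  rw [← Ideal.span_union] at hy
  induction hy using Submodule.span_induction with
  | mem g hg => exact hg.elim (hs g) (ht g)
  | zero => simp
  | add a b _ _ ha hb => rw [mul_add]; exact add_mem ha hb
  | smul a b _ hb => rw [smul_eq_mul, mul_left_comm]; exact Ideal.mul_mem_left _ _ hb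

/-! ## The key lemma: variables are non-zero-divisors modulo monomial ideals in the others -/

/-- The colon step.  Write `B'' = {b ∈ B : b_j = 0}` and `B' = {b ∸ e_j : b ∈ B}` (lowering the
`j`-th exponent by one where positive).  If `u_j` is a non-zero-divisor modulo
`(u_T) + (u^b : b ∈ B'')`, then `u_j z ∈ (u_T) + (u^b : b ∈ B)` implies
`z ∈ (u_T) + (u^{b'} : b' ∈ B')`. [folklore] -/
theorem mem_span_uPow_lower_of_mul_mem_of_sat (u : Fin N → S) (T : Finset (Fin N))
    (B : Finset (Fin N → ℕ)) (j : Fin N)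
    (hsat : ∀ z, u j * z ∈ Ideal.span (u '' ↑T) ⊔
        Ideal.span (uPow u '' ↑(B.filter (fun b => b j = 0))) →
      z ∈ Ideal.span (u '' ↑T) ⊔ Ideal.span (uPow u '' ↑(B.filter (fun b => b j = 0))))
    {z : S} (hz : u j * z ∈ Ideal.span (u '' ↑T) ⊔ Ideal.span (uPow u '' ↑B)) :
    z ∈ Ideal.span (u '' ↑T) ⊔
      Ideal.span (uPow u '' ↑(B.image (fun b => if 0 < b j then b - Pi.single j 1 else b))) := by
  classical
  set φ : (Fin N → ℕ) → (Fin N → ℕ) := fun b => if 0 < b j then b - Pi.single j 1 else b with hφ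
  obtain ⟨t, ht, s, hs, hts⟩ := Submodule.mem_sup.mp hz
  obtain ⟨c, hc⟩ := (Submodule.mem_span_image_finset_iff_exists_fun' (R := S)).mp hs
  -- split the sum according to `b_j > 0` / `b_j = 0`
  set w := ∑ b ∈ B.filter (fun b => 0 < b j), c b * uPow u (b - Pi.single j 1) with hw
  have hsplit : ∑ b ∈ B, c b • uPow u b =
      u j * w + ∑ b ∈ B.filter (fun b => b j = 0), c b * uPow u b := by
    rw [← Finset.sum_filter_add_sum_filter_not B (fun b => 0 < b j)]
    congr 1
    · rw [hw, Finset.mul_sum]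
      refine Finset.sum_congr rfl fun b hb => ?_
      rw [smul_eq_mul, ← mul_uPow_sub_single u (Finset.mem_filter.mp hb).2]
      ring
    · refine Finset.sum_congr ?_ fun b _ => rfl
      ext b
      simp [Nat.pos_iff_ne_zero]
  have hwmem : w ∈ Ideal.span (uPow u '' ↑(B.image φ)) := by
    refine Submodule.sum_mem _ fun b hb => Ideal.mul_mem_left _ _ (Ideal.subset_span ⟨φ b, ?_, ?_⟩)
    · exact Finset.mem_coe.mpr (Finset.mem_image_of_mem φ (Finset.mem_filter.mp hb).1)
    · simp [hφ, (Finset.mem_filter.mp hb).2]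
  have hrest : u j * (z - w) ∈ Ideal.span (u '' ↑T) ⊔
      Ideal.span (uPow u '' ↑(B.filter (fun b => b j = 0))) := by
    have : u j * (z - w) = t + ∑ b ∈ B.filter (fun b => b j = 0), c b * uPow u b := by
      have h1 : u j * z = t + (u j * w + ∑ b ∈ B.filter (fun b => b j = 0), c b * uPow u b) := by
        rw [← hsplit, hc, hts]
      rw [mul_sub, h1]
      ring
    rw [this]
    refine add_mem (Ideal.mem_sup_left ht) (Ideal.mem_sup_right ?_)
    refine Submodule.sum_mem _ fun b hb => Ideal.mul_mem_left _ _ (Ideal.subset_span ⟨b, ?_, rfl⟩)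
    exact Finset.mem_coe.mpr hb
  have h1 := hsat _ hrest
  -- `B'' ⊆ B'`
  have hle : Ideal.span (u '' ↑T) ⊔ Ideal.span (uPow u '' ↑(B.filter (fun b => b j = 0))) ≤
      Ideal.span (u '' ↑T) ⊔ Ideal.span (uPow u '' ↑(B.image φ)) := by
    refine sup_le_sup_left (Ideal.span_mono (Set.image_mono fun b hb => ?_)) _
    have hb' := Finset.mem_filter.mp (Finset.mem_coe.mp hb)
    refine Finset.mem_coe.mpr (Finset.mem_image.mpr ⟨b, hb'.1, ?_⟩)
    simp [hφ, hb'.2]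
  have : z = (z - w) + w := by ring
  rw [this]
  exact add_mem (hle h1) (Ideal.mem_sup_right hwmem)

/-- The re-assembly step: `u_j · ((u_T) + (u^{b'} : b' ∈ B')) ⊆ (u_T) + (u^b : b ∈ B)` for the
lowered family `B'`. [folklore] -/
theorem mul_mem_sup_span_uPow_of_mem_lower (u : Fin N → S) (T : Finset (Fin N))
    (B : Finset (Fin N → ℕ)) (j : Fin N) {y : S}
    (hy : y ∈ Ideal.span (u '' ↑T) ⊔
      Ideal.span (uPow u '' ↑(B.image (fun b => if 0 < b j then b - Pi.single j 1 else b)))) :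
    u j * y ∈ Ideal.span (u '' ↑T) ⊔ Ideal.span (uPow u '' ↑B) := by
  classical
  refine mul_mem_of_forall_mem_sup_span (fun g hg => ?_) (fun g hg => ?_) hy
  · exact Ideal.mem_sup_left (Ideal.mul_mem_left _ _ (Ideal.subset_span hg))
  · obtain ⟨b', hb', rfl⟩ := hg
    obtain ⟨b, hb, rfl⟩ := Finset.mem_image.mp (Finset.mem_coe.mp hb')
    refine Ideal.mem_sup_right ?_
    by_cases hbj : 0 < b j
    · rw [if_pos hbj, mul_uPow_sub_single u hbj]
      exact uPow_mem_span_uPow u (Finset.mem_coe.mpr hb)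
    · rw [if_neg hbj]
      exact Ideal.mul_mem_left _ _ (uPow_mem_span_uPow u (Finset.mem_coe.mpr hb))

/-- `(u_T) + (u^b : b ∈ B) ⊆ (u_{T ∪ {j}}) + (u^b : b ∈ B, b_j = 0)`. [folklore] -/
theorem sup_span_uPow_le_insert_filter (u : Fin N → S) (T : Finset (Fin N))
    (B : Finset (Fin N → ℕ)) (j : Fin N) :
    Ideal.span (u '' ↑T) ⊔ Ideal.span (uPow u '' ↑B) ≤
      Ideal.span (u '' ↑(insert j T)) ⊔ Ideal.span (uPow u '' ↑(B.filter (fun b => b j = 0))) := by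
  classical
  refine sup_le ?_ ?_
  · exact le_sup_of_le_left (Ideal.span_mono (Set.image_mono (by simp)))
  · rw [span_uPow_le_iff]
    intro b hb
    by_cases hbj : b j = 0
    · exact Ideal.mem_sup_right (uPow_mem_span_uPow u (by
        exact Finset.mem_coe.mpr (Finset.mem_filter.mpr ⟨Finset.mem_coe.mp hb, hbj⟩)))
    · obtain ⟨c, hc⟩ := dvd_uPow_of_pos u (Nat.pos_of_ne_zero hbj)
      rw [hc]
      refine Ideal.mem_sup_left (Ideal.mul_mem_right _ _ (Ideal.subset_span ⟨j, ?_, rfl⟩))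
      simp

/-- **Key lemma** (monomial ideals in a family satisfying (H)): if `i ∉ T` and no exponent
vector in `B` involves the variable `i`, then `u_i` is a non-zero-divisor modulo
`(u_t : t ∈ T) + (u^b : b ∈ B)`.  Proof by induction on the exponent mass of `B` outside `T`,
through the exact sequence `0 → S/((u_T) + (u^{B'})) —u_j→ S/((u_T) + (u^B)) → S/((u_{T∪j}) +
(u^{B''})) → 0` for a variable `j` occurring in `B`. [folklore] -/
theorem mem_of_mul_mem_sup_span_uPow (u : Fin N → S)
    (H : ∀ (i : Fin N) (T : Finset (Fin N)), i ∉ T →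
      ∀ y, u i * y ∈ Ideal.span (u '' ↑T) → y ∈ Ideal.span (u '' ↑T))
    (T : Finset (Fin N)) (B : Finset (Fin N → ℕ)) (i : Fin N) (hiT : i ∉ T)
    (hBi : ∀ b ∈ B, b i = 0) {y : S}
    (hy : u i * y ∈ Ideal.span (u '' ↑T) ⊔ Ideal.span (uPow u '' ↑B)) :
    y ∈ Ideal.span (u '' ↑T) ⊔ Ideal.span (uPow u '' ↑B) := by
  classical
  -- strong induction on the exponent mass outside `T`
  suffices key : ∀ (D : ℕ) (T : Finset (Fin N)) (B : Finset (Fin N → ℕ)) (i : Fin N),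
      ∑ b ∈ B, ∑ l ∈ Tᶜ, b l = D → i ∉ T → (∀ b ∈ B, b i = 0) →
      ∀ y, u i * y ∈ Ideal.span (u '' ↑T) ⊔ Ideal.span (uPow u '' ↑B) →
        y ∈ Ideal.span (u '' ↑T) ⊔ Ideal.span (uPow u '' ↑B) from
    key _ T B i rfl hiT hBi y hy
  intro D
  induction D using Nat.strong_induction_on with
  | _ D ih =>
  intro T B i hD hiT hBi y hy
  by_cases hex : ∃ b ∈ B, ∃ j ∉ T, 0 < b j
  swap
  · -- every exponent vector of `B` is supported on `T`
    push Not at hex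
    by_cases h0 : (0 : Fin N → ℕ) ∈ B
    · have h1 : (1 : S) ∈ Ideal.span (uPow u '' ↑B) := by
        have := uPow_mem_span_uPow u (B := ↑B) (Finset.mem_coe.mpr h0)
        rwa [uPow_zero] at this
      have htop : Ideal.span (u '' ↑T) ⊔ Ideal.span (uPow u '' ↑B) = ⊤ :=
        (Ideal.eq_top_iff_one _).mpr (Ideal.mem_sup_right h1)
      rw [htop]
      trivial
    · have hle : Ideal.span (uPow u '' ↑B) ≤ Ideal.span (u '' ↑T) := by
        rw [span_uPow_le_iff]
        intro b hb
        have hb' : b ∈ B := Finset.mem_coe.mp hb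
        obtain ⟨l, hl⟩ : ∃ l, b l ≠ 0 := by
          by_contra hcon
          push Not at hcon
          exact h0 ((funext hcon : b = 0) ▸ hb')
        have hlT : l ∈ T := by
          by_contra hlT
          exact hl (Nat.le_zero.mp (hex b hb' l hlT))
        obtain ⟨c, hc⟩ := dvd_uPow_of_pos u (Nat.pos_of_ne_zero hl)
        rw [hc]
        exact Ideal.mul_mem_right _ _ (Ideal.subset_span ⟨l, Finset.mem_coe.mpr hlT, rfl⟩)
      have heq : Ideal.span (u '' ↑T) ⊔ Ideal.span (uPow u '' ↑B) = Ideal.span (u '' ↑T) :=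
        sup_eq_left.mpr hle
      rw [heq] at hy ⊢
      exact H i T hiT y hy
  · obtain ⟨b₀, hb₀, j, hjT, hj⟩ := hex
    have hji : j ≠ i := by
      rintro rfl
      rw [hBi b₀ hb₀] at hj
      exact lt_irrefl 0 hj
    set φ : (Fin N → ℕ) → (Fin N → ℕ) := fun b => if 0 < b j then b - Pi.single j 1 else b
      with hφ
    -- the three measures
    have hrow : ∀ {a b : Fin N → ℕ}, a ≤ b → ∑ l ∈ Tᶜ, a l ≤ ∑ l ∈ Tᶜ, b l :=
      fun h => Finset.sum_le_sum fun l _ => h l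
    have hφle : ∀ b, φ b ≤ b := by
      intro b
      by_cases hb : 0 < b j
      · simp only [hφ, if_pos hb]
        exact fun l => Nat.sub_le _ _
      · simp only [hφ, if_neg hb]
        exact le_rfl
    have hjc : j ∈ Tᶜ := Finset.mem_compl.mpr hjT
    have m1 : ∑ b ∈ B.filter (fun b => b j = 0), ∑ l ∈ Tᶜ, b l < D := by
      rw [← hD]
      refine Finset.sum_lt_sum_of_subset (Finset.filter_subset _ B) hb₀ ?_ ?_ fun _ _ _ => Nat.zero_le _
      · simp [hj.ne']
      · exact lt_of_lt_of_le hj (Finset.single_le_sum (f := fun l => b₀ l) (fun _ _ => Nat.zero_le _) hjc)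
    have m2 : ∑ b ∈ B.filter (fun b => b j = 0), ∑ l ∈ (insert j T)ᶜ, b l < D := by
      refine lt_of_le_of_lt (Finset.sum_le_sum fun b _ => ?_) m1
      exact Finset.sum_le_sum_of_subset
        (Finset.compl_subset_compl.mpr (Finset.subset_insert j T))
    have m3 : ∑ b ∈ B.image φ, ∑ l ∈ Tᶜ, b l < D := by
      refine lt_of_le_of_lt (Finset.sum_image_le_of_nonneg fun _ _ => Nat.zero_le _) ?_
      rw [← hD]
      refine Finset.sum_lt_sum (fun b _ => hrow (hφle b)) ⟨b₀, hb₀, ?_⟩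
      refine Finset.sum_lt_sum (fun l _ => hφle b₀ l) ⟨j, hjc, ?_⟩
      simp only [hφ, if_pos hj, Pi.sub_apply, Pi.single_eq_same]
      omega
    -- Step A: reduce modulo `u_j`
    have hyA : y ∈ Ideal.span (u '' ↑(insert j T)) ⊔
        Ideal.span (uPow u '' ↑(B.filter (fun b => b j = 0))) := by
      refine ih _ m2 (insert j T) (B.filter (fun b => b j = 0)) i rfl ?_ ?_ y
        (sup_span_uPow_le_insert_filter u T B j hy)
      · simp [hji.symm, hiT]
      · exact fun b hb => hBi b (Finset.mem_filter.mp hb).1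
    -- decompose `y = u_j y' + y''`
    have hyA' : y ∈ Ideal.span {u j} ⊔ (Ideal.span (u '' ↑T) ⊔
        Ideal.span (uPow u '' ↑(B.filter (fun b => b j = 0)))) := by
      rwa [Finset.coe_insert, Set.image_insert_eq, Ideal.span_insert, sup_assoc] at hyA
    obtain ⟨v, hv, y'', hy'', hvy⟩ := Submodule.mem_sup.mp hyA'
    obtain ⟨y', rfl⟩ := Ideal.mem_span_singleton'.mp hv
    have hy''B : y'' ∈ Ideal.span (u '' ↑T) ⊔ Ideal.span (uPow u '' ↑B) := by
      have hle : Ideal.span (u '' ↑T) ⊔ Ideal.span (uPow u '' ↑(B.filter (fun b => b j = 0))) ≤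
          Ideal.span (u '' ↑T) ⊔ Ideal.span (uPow u '' ↑B) := by
        refine sup_le_sup_left (Ideal.span_mono (Set.image_mono ?_)) _
        exact fun b hb => Finset.mem_coe.mpr (Finset.mem_filter.mp (Finset.mem_coe.mp hb)).1
      exact hle hy''
    -- Step B/C: `u_j (u_i y') ∈ (u_T) + (u^B)`, hence `u_i y' ∈ (u_T) + (u^{B'})`
    have hjz : u j * (u i * y') ∈ Ideal.span (u '' ↑T) ⊔ Ideal.span (uPow u '' ↑B) := by
      have : u j * (u i * y') = u i * y - u i * y'' := by rw [← hvy]; ring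
      rw [this]
      exact sub_mem hy (Ideal.mul_mem_left _ _ hy''B)
    have hz : u i * y' ∈ Ideal.span (u '' ↑T) ⊔ Ideal.span (uPow u '' ↑(B.image φ)) :=
      mem_span_uPow_lower_of_mul_mem_of_sat u T B j
        (fun z hz => ih _ m1 T _ j rfl hjT (fun b hb => (Finset.mem_filter.mp hb).2) z hz) hjz
    -- Step D: induction for the lowered family
    have hy' : y' ∈ Ideal.span (u '' ↑T) ⊔ Ideal.span (uPow u '' ↑(B.image φ)) := by
      refine ih _ m3 T (B.image φ) i rfl hiT ?_ y' hz
      intro b' hb'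
      obtain ⟨b, hb, rfl⟩ := Finset.mem_image.mp hb'
      exact Nat.le_zero.mp ((hφle b i).trans (hBi b hb).le)
    -- Step E: reassemble
    rw [← hvy]
    exact add_mem (by rw [mul_comm]; exact mul_mem_sup_span_uPow_of_mem_lower u T B j hy') hy''B

/-! ## Colon formulas -/

/-- `(u_T) + (u^b : b ∈ ∅)`-type bookkeeping: the `T = ∅` summand vanishes. [folklore] -/
theorem span_image_coe_empty_sup (u : Fin N → S) (I : Ideal S) :
    Ideal.span (u '' ↑(∅ : Finset (Fin N))) ⊔ I = I := by
  rw [Finset.coe_empty, Set.image_empty, Ideal.span_empty, bot_sup_eq]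

/-- **Colon by a variable**: for `j ∉ T`, `u_j z ∈ (u_T) + (u^b : b ∈ B)` iff
`z ∈ (u_T) + (u^{b ∸ e_j} : b ∈ B)`. [folklore] -/
theorem mul_mem_sup_span_uPow_iff (u : Fin N → S)
    (H : ∀ (i : Fin N) (T : Finset (Fin N)), i ∉ T →
      ∀ y, u i * y ∈ Ideal.span (u '' ↑T) → y ∈ Ideal.span (u '' ↑T))
    (T : Finset (Fin N)) (B : Finset (Fin N → ℕ)) {j : Fin N} (hjT : j ∉ T) {z : S} :
    u j * z ∈ Ideal.span (u '' ↑T) ⊔ Ideal.span (uPow u '' ↑B) ↔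
      z ∈ Ideal.span (u '' ↑T) ⊔
        Ideal.span (uPow u '' ↑(B.image (fun b => if 0 < b j then b - Pi.single j 1 else b))) := by
  refine ⟨fun hz => ?_, mul_mem_sup_span_uPow_of_mem_lower u T B j⟩
  refine mem_span_uPow_lower_of_mul_mem_of_sat u T B j (fun w hw => ?_) hz
  exact mem_of_mul_mem_sup_span_uPow u H T _ j hjT (fun b hb => (Finset.mem_filter.mp hb).2) hw

/-- Colon by a variable, `T = ∅`: `u_j z ∈ (u^b : b ∈ B) ⟺ z ∈ (u^{b ∸ e_j} : b ∈ B)`. [folklore] -/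
theorem mul_mem_span_uPow_finset_iff (u : Fin N → S)
    (H : ∀ (i : Fin N) (T : Finset (Fin N)), i ∉ T →
      ∀ y, u i * y ∈ Ideal.span (u '' ↑T) → y ∈ Ideal.span (u '' ↑T))
    (B : Finset (Fin N → ℕ)) (j : Fin N) {z : S} :
    u j * z ∈ Ideal.span (uPow u '' ↑B) ↔
      z ∈ Ideal.span (uPow u '' ↑(B.image (fun b => if 0 < b j then b - Pi.single j 1 else b))) := by
  have h := mul_mem_sup_span_uPow_iff u H ∅ B (j := j) (Finset.notMem_empty j) (z := z)
  rwa [span_image_coe_empty_sup, span_image_coe_empty_sup] at h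

/-- A variable not occurring in `B` is a non-zero-divisor modulo `(u^b : b ∈ B)` (`T = ∅`).
[folklore] -/
theorem mem_of_mul_mem_span_uPow (u : Fin N → S)
    (H : ∀ (i : Fin N) (T : Finset (Fin N)), i ∉ T →
      ∀ y, u i * y ∈ Ideal.span (u '' ↑T) → y ∈ Ideal.span (u '' ↑T))
    (B : Finset (Fin N → ℕ)) (i : Fin N) (hBi : ∀ b ∈ B, b i = 0) {y : S}
    (hy : u i * y ∈ Ideal.span (uPow u '' ↑B)) : y ∈ Ideal.span (uPow u '' ↑B) := by
  have h := mem_of_mul_mem_sup_span_uPow u H ∅ B i (Finset.notMem_empty i) hBi (y := y)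
  rw [span_image_coe_empty_sup] at h
  exact h hy

/-- **Colon by a monomial**: `u^a z ∈ (u^b : b ∈ B) ⟺ z ∈ (u^{b ∸ a} : b ∈ B)` (truncated
subtraction of exponents). [folklore] -/
theorem uPow_mul_mem_span_uPow_finset_iff (u : Fin N → S)
    (H : ∀ (i : Fin N) (T : Finset (Fin N)), i ∉ T →
      ∀ y, u i * y ∈ Ideal.span (u '' ↑T) → y ∈ Ideal.span (u '' ↑T))
    (B : Finset (Fin N → ℕ)) (a : Fin N → ℕ) {z : S} :
    uPow u a * z ∈ Ideal.span (uPow u '' ↑B) ↔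
      z ∈ Ideal.span (uPow u '' ↑(B.image (fun b => b - a))) := by
  classical
  suffices key : ∀ (n : ℕ) (a : Fin N → ℕ) (B : Finset (Fin N → ℕ)), ∑ l, a l = n → ∀ z : S,
      (uPow u a * z ∈ Ideal.span (uPow u '' ↑B) ↔
        z ∈ Ideal.span (uPow u '' ↑(B.image (fun b => b - a)))) from key _ a B rfl z
  intro n
  induction n with
  | zero =>
    intro a B ha z
    have ha0 : a = 0 := funext fun l => Finset.sum_eq_zero_iff.mp ha l (Finset.mem_univ l)
    subst ha0
    have h0 : (fun b : Fin N → ℕ => b - 0) = id := by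
      funext b
      funext l
      simp
    rw [h0, Finset.image_id, uPow_zero, one_mul]
  | succ n ih =>
    intro a B ha z
    obtain ⟨j, hj⟩ : ∃ j, 0 < a j := by
      by_contra hcon
      push Not at hcon
      have : ∑ l, a l = 0 := Finset.sum_eq_zero fun l _ => Nat.le_zero.mp (hcon l)
      omega
    set a' : Fin N → ℕ := a - Pi.single j 1 with ha'
    have haa' : a = a' + Pi.single j 1 := by
      funext l
      by_cases hl : l = j
      · subst hl
        simp only [ha', Pi.add_apply, Pi.sub_apply, Pi.single_eq_same]
        omega
      · simp [ha', hl]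
    have hsum : ∑ l, a' l = n := by
      have h1 : ∑ l, a l = ∑ l, a' l + ∑ l, (Pi.single j 1 : Fin N → ℕ) l := by
        rw [← Finset.sum_add_distrib]
        exact Finset.sum_congr rfl fun l _ => by rw [haa']; rfl
      rw [Finset.sum_pi_single'] at h1
      simp only [Finset.mem_univ, if_true] at h1
      omega
    rw [← mul_uPow_sub_single u hj, mul_assoc, mul_mem_span_uPow_finset_iff u H B j,
      ih a' _ hsum z]
    suffices heq : (B.image (fun b => if 0 < b j then b - Pi.single j 1 else b)).image
        (fun b => b - a') = B.image (fun b => b - a) by rw [heq]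
    rw [Finset.image_image]
    refine Finset.image_congr fun b _ => ?_
    show (if 0 < b j then b - Pi.single j 1 else b) - a' = b - a
    funext l
    by_cases hl : l = j
    · subst hl
      by_cases hb : 0 < b l
      · simp only [if_pos hb, ha', Pi.sub_apply, Pi.single_eq_same]
        omega
      · simp only [if_neg hb, ha', Pi.sub_apply, Pi.single_eq_same]
        omega
    · by_cases hb : 0 < b j
      · simp [if_pos hb, ha', hl]
      · simp [if_neg hb, ha', hl]

/-! ## Finite generation of monomial ideals (Dickson) -/

/-- **Dickson's lemma** in the form used here: every set of exponent vectors has a finite subset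
below all of it (its minimal elements). [folklore] -/
theorem exists_finset_forall_exists_le (B : Set (Fin N → ℕ)) :
    ∃ B₀ : Finset (Fin N → ℕ), ↑B₀ ⊆ B ∧ ∀ b ∈ B, ∃ b₀ ∈ B₀, b₀ ≤ b := by
  have hpwo : B.IsPWO := Set.isPWO_of_wellQuasiOrderedLE B
  have hfin : {a | Minimal (· ∈ B) a}.Finite :=
    (setOf_minimal_antichain (· ∈ B)).finite_of_partiallyWellOrderedOn
      (hpwo.mono (setOf_minimal_subset B))
  refine ⟨hfin.toFinset, by simpa using setOf_minimal_subset B, fun b hb => ?_⟩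
  obtain ⟨a, hab, ha⟩ := hpwo.exists_le_minimal hb
  exact ⟨a, hfin.mem_toFinset.mpr ha, hab⟩

/-- A monomial ideal is generated by finitely many of its monomials, lying below all the others.
[folklore] -/
theorem exists_finset_span_uPow_eq (u : Fin N → S) (B : Set (Fin N → ℕ)) :
    ∃ B₀ : Finset (Fin N → ℕ), ↑B₀ ⊆ B ∧ (∀ b ∈ B, ∃ b₀ ∈ B₀, b₀ ≤ b) ∧
      Ideal.span (uPow u '' B) = Ideal.span (uPow u '' ↑B₀) := by
  obtain ⟨B₀, hB₀, hle⟩ := exists_finset_forall_exists_le B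
  refine ⟨B₀, hB₀, hle, le_antisymm (span_uPow_mono_of_forall_exists_le u hle) ?_⟩
  exact Ideal.span_mono (Set.image_mono hB₀)

/-! ## Membership, colon and intersection for arbitrary sets of exponents -/

/-- **Colon by a monomial** (general sets of exponents):
`u^a z ∈ (u^b : b ∈ B) ⟺ z ∈ (u^{b ∸ a} : b ∈ B)`. [folklore] -/
theorem uPow_mul_mem_span_uPow_iff (u : Fin N → S)
    (H : ∀ (i : Fin N) (T : Finset (Fin N)), i ∉ T →
      ∀ y, u i * y ∈ Ideal.span (u '' ↑T) → y ∈ Ideal.span (u '' ↑T))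
    (B : Set (Fin N → ℕ)) (a : Fin N → ℕ) {z : S} :
    uPow u a * z ∈ Ideal.span (uPow u '' B) ↔
      z ∈ Ideal.span (uPow u '' ((fun b => b - a) '' B)) := by
  classical
  obtain ⟨B₀, hB₀, hle, heq⟩ := exists_finset_span_uPow_eq u B
  have heq' : Ideal.span (uPow u '' ((fun b => b - a) '' B)) =
      Ideal.span (uPow u '' ↑(B₀.image (fun b => b - a))) := by
    apply le_antisymm
    · refine span_uPow_mono_of_forall_exists_le u fun c hc => ?_
      obtain ⟨b, hb, rfl⟩ := hc
      obtain ⟨b₀, hb₀, hb₀b⟩ := hle b hb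
      exact ⟨b₀ - a, Finset.mem_coe.mpr (Finset.mem_image_of_mem _ hb₀),
        fun l => Nat.sub_le_sub_right (hb₀b l) _⟩
    · refine Ideal.span_mono (Set.image_mono fun c hc => ?_)
      obtain ⟨b₀, hb₀, rfl⟩ := Finset.mem_image.mp (Finset.mem_coe.mp hc)
      exact ⟨b₀, hB₀ (Finset.mem_coe.mpr hb₀), rfl⟩
  rw [heq, heq', uPow_mul_mem_span_uPow_finset_iff u H B₀ a]

/-- **Monomial membership is combinatorial**: if `(u) ≠ S` then
`u^a ∈ (u^b : b ∈ B) ⟺ ∃ b ∈ B, b ≤ a`. [folklore] -/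
theorem uPow_mem_span_uPow_iff (u : Fin N → S)
    (H : ∀ (i : Fin N) (T : Finset (Fin N)), i ∉ T →
      ∀ y, u i * y ∈ Ideal.span (u '' ↑T) → y ∈ Ideal.span (u '' ↑T))
    (hu : Ideal.span (Set.range u) ≠ ⊤) (B : Set (Fin N → ℕ)) (a : Fin N → ℕ) :
    uPow u a ∈ Ideal.span (uPow u '' B) ↔ ∃ b ∈ B, b ≤ a := by
  refine ⟨fun h => ?_, fun ⟨b, hb, hba⟩ => uPow_mem_span_uPow_of_le u hb hba⟩
  have h1 : (1 : S) ∈ Ideal.span (uPow u '' ((fun b => b - a) '' B)) := by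
    rw [← uPow_mul_mem_span_uPow_iff u H B a, mul_one]
    exact h
  by_contra hne
  push Not at hne
  apply hu
  rw [Ideal.eq_top_iff_one]
  refine (span_uPow_le_iff u).mpr (fun c hc => ?_) h1
  obtain ⟨b, hb, rfl⟩ := hc
  -- `b - a ≠ 0`, so `u^{b-a} ∈ (u)`
  obtain ⟨l, hl⟩ : ∃ l, ¬ b l ≤ a l := by
    by_contra hcon
    push Not at hcon
    exact hne b hb hcon
  obtain ⟨c, hc⟩ := dvd_uPow_of_pos u (b := b - a) (j := l) (by simp only [Pi.sub_apply]; omega)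
  rw [hc]
  exact Ideal.mul_mem_right _ _ (Ideal.subset_span (Set.mem_range_self l))

/-! ## Intersections of monomial ideals -/

/-- Measure bookkeeping: dropping the generators involving `u_j` and adjoining `j` to `T` does not
increase the exponent mass outside `T`. [folklore] -/
theorem sum_filter_sum_compl_insert_le (T : Finset (Fin N)) (B : Finset (Fin N → ℕ)) (j : Fin N) :
    ∑ b ∈ B.filter (fun b => b j = 0), ∑ l ∈ (insert j T)ᶜ, b l ≤ ∑ b ∈ B, ∑ l ∈ Tᶜ, b l := by
  classical
  calc ∑ b ∈ B.filter (fun b => b j = 0), ∑ l ∈ (insert j T)ᶜ, b l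
      ≤ ∑ b ∈ B.filter (fun b => b j = 0), ∑ l ∈ Tᶜ, b l :=
        Finset.sum_le_sum fun b _ => Finset.sum_le_sum_of_subset
          (Finset.compl_subset_compl.mpr (Finset.subset_insert j T))
    _ ≤ ∑ b ∈ B, ∑ l ∈ Tᶜ, b l :=
        Finset.sum_le_sum_of_subset_of_nonneg (Finset.filter_subset _ B) fun _ _ _ => Nat.zero_le _

/-- … and decreases it strictly if `u_j`, `j ∉ T`, occurs in `B`. [folklore] -/
theorem sum_filter_sum_compl_insert_lt (T : Finset (Fin N)) (B : Finset (Fin N → ℕ)) {j : Fin N}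
    (hjT : j ∉ T) {b₀ : Fin N → ℕ} (hb₀ : b₀ ∈ B) (hj : 0 < b₀ j) :
    ∑ b ∈ B.filter (fun b => b j = 0), ∑ l ∈ (insert j T)ᶜ, b l < ∑ b ∈ B, ∑ l ∈ Tᶜ, b l := by
  classical
  calc ∑ b ∈ B.filter (fun b => b j = 0), ∑ l ∈ (insert j T)ᶜ, b l
      ≤ ∑ b ∈ B.filter (fun b => b j = 0), ∑ l ∈ Tᶜ, b l :=
        Finset.sum_le_sum fun b _ => Finset.sum_le_sum_of_subset
          (Finset.compl_subset_compl.mpr (Finset.subset_insert j T))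
    _ < ∑ b ∈ B, ∑ l ∈ Tᶜ, b l := by
        refine Finset.sum_lt_sum_of_subset (Finset.filter_subset _ B) hb₀ ?_ ?_
          fun _ _ _ => Nat.zero_le _
        · simp [hj.ne']
        · exact lt_of_lt_of_le hj (Finset.single_le_sum (f := fun l => b₀ l)
            (fun _ _ => Nat.zero_le _) (Finset.mem_compl.mpr hjT))

/-- Measure bookkeeping: lowering the `j`-th exponents does not increase the exponent mass
outside `T`. [folklore] -/
theorem sum_image_lower_sum_compl_le (T : Finset (Fin N)) (B : Finset (Fin N → ℕ)) (j : Fin N) :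
    ∑ b ∈ B.image (fun b => if 0 < b j then b - Pi.single j 1 else b), ∑ l ∈ Tᶜ, b l ≤
      ∑ b ∈ B, ∑ l ∈ Tᶜ, b l := by
  classical
  refine (Finset.sum_image_le_of_nonneg fun _ _ => Nat.zero_le _).trans ?_
  refine Finset.sum_le_sum fun b _ => Finset.sum_le_sum fun l _ => ?_
  by_cases hb : 0 < b j
  · rw [if_pos hb]
    exact Nat.sub_le _ _
  · rw [if_neg hb]

/-- … and decreases it strictly if `u_j`, `j ∉ T`, occurs in `B`. [folklore] -/
theorem sum_image_lower_sum_compl_lt (T : Finset (Fin N)) (B : Finset (Fin N → ℕ)) {j : Fin N}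
    (hjT : j ∉ T) {b₀ : Fin N → ℕ} (hb₀ : b₀ ∈ B) (hj : 0 < b₀ j) :
    ∑ b ∈ B.image (fun b => if 0 < b j then b - Pi.single j 1 else b), ∑ l ∈ Tᶜ, b l <
      ∑ b ∈ B, ∑ l ∈ Tᶜ, b l := by
  classical
  refine lt_of_le_of_lt (Finset.sum_image_le_of_nonneg fun _ _ => Nat.zero_le _) ?_
  have hle : ∀ b : Fin N → ℕ, (if 0 < b j then b - Pi.single j 1 else b) ≤ b := by
    intro b
    by_cases hb : 0 < b j
    · rw [if_pos hb]
      exact fun l => Nat.sub_le _ _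
    · rw [if_neg hb]
  refine Finset.sum_lt_sum (fun b _ => Finset.sum_le_sum fun l _ => hle b l) ⟨b₀, hb₀, ?_⟩
  refine Finset.sum_lt_sum (fun l _ => hle b₀ l) ⟨j, Finset.mem_compl.mpr hjT, ?_⟩
  simp only [if_pos hj, Pi.sub_apply, Pi.single_eq_same]
  omega

/-- **Intersection of monomial ideals** (`T`-version): `((u_T) + (u^b : b ∈ B)) ∩ ((u_T) +
(u^c : c ∈ C)) = (u_T) + (u^{b ⊔ c} : b ∈ B, c ∈ C)`. [folklore] -/
theorem sup_span_uPow_inf_sup_span_uPow (u : Fin N → S)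
    (H : ∀ (i : Fin N) (T : Finset (Fin N)), i ∉ T →
      ∀ y, u i * y ∈ Ideal.span (u '' ↑T) → y ∈ Ideal.span (u '' ↑T))
    (T : Finset (Fin N)) (B C : Finset (Fin N → ℕ)) :
    (Ideal.span (u '' ↑T) ⊔ Ideal.span (uPow u '' ↑B)) ⊓
        (Ideal.span (u '' ↑T) ⊔ Ideal.span (uPow u '' ↑C)) =
      Ideal.span (u '' ↑T) ⊔ Ideal.span (uPow u '' ↑((B ×ˢ C).image (fun p => p.1 ⊔ p.2))) := by
  classical
  apply le_antisymm
  swap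
  · refine le_inf (sup_le_sup_left (span_uPow_mono_of_forall_exists_le u fun a ha => ?_) _)
      (sup_le_sup_left (span_uPow_mono_of_forall_exists_le u fun a ha => ?_) _)
    · obtain ⟨p, hp, rfl⟩ := Finset.mem_image.mp (Finset.mem_coe.mp ha)
      exact ⟨p.1, Finset.mem_coe.mpr (Finset.mem_product.mp hp).1, le_sup_left⟩
    · obtain ⟨p, hp, rfl⟩ := Finset.mem_image.mp (Finset.mem_coe.mp ha)
      exact ⟨p.2, Finset.mem_coe.mpr (Finset.mem_product.mp hp).2, le_sup_right⟩
  -- `⊆`: strong induction on the exponent mass of `B` and `C` outside `T`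
  suffices key : ∀ (D : ℕ) (T : Finset (Fin N)) (B C : Finset (Fin N → ℕ)),
      ∑ b ∈ B, ∑ l ∈ Tᶜ, b l + ∑ c ∈ C, ∑ l ∈ Tᶜ, c l = D → ∀ f : S,
      f ∈ Ideal.span (u '' ↑T) ⊔ Ideal.span (uPow u '' ↑B) →
      f ∈ Ideal.span (u '' ↑T) ⊔ Ideal.span (uPow u '' ↑C) →
      f ∈ Ideal.span (u '' ↑T) ⊔
        Ideal.span (uPow u '' ↑((B ×ˢ C).image (fun p => p.1 ⊔ p.2))) from
    fun f hf => key _ T B C rfl f hf.1 hf.2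
  intro D
  induction D using Nat.strong_induction_on with
  | _ D ih =>
  intro T B C hD f hfB hfC
  -- generators of `B` below `0 ⊔ c`: if `0 ∈ B` the claim is `f ∈ (u_T) + (u^C)`-easy
  have hzero : ∀ (B C : Finset (Fin N → ℕ)), (0 : Fin N → ℕ) ∈ B →
      Ideal.span (u '' ↑T) ⊔ Ideal.span (uPow u '' ↑C) ≤ Ideal.span (u '' ↑T) ⊔
        Ideal.span (uPow u '' ↑((B ×ˢ C).image (fun p => p.1 ⊔ p.2))) := by
    intro B C h0
    refine sup_le_sup_left (span_uPow_mono_of_forall_exists_le u fun c hc => ?_) _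
    refine ⟨(0 : Fin N → ℕ) ⊔ c, Finset.mem_coe.mpr (Finset.mem_image.mpr ⟨(0, c),
      Finset.mem_product.mpr ⟨h0, Finset.mem_coe.mp hc⟩, rfl⟩), ?_⟩
    exact le_of_eq (bot_sup_eq c)
  by_cases hex : ∃ b ∈ B ∪ C, ∃ j ∉ T, 0 < b j
  swap
  · push Not at hex
    by_cases hB0 : (0 : Fin N → ℕ) ∈ B
    · exact hzero B C hB0 hfC
    by_cases hC0 : (0 : Fin N → ℕ) ∈ C
    · have hswap : Ideal.span (uPow u '' ↑((C ×ˢ B).image (fun p => p.1 ⊔ p.2))) =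
          Ideal.span (uPow u '' ↑((B ×ˢ C).image (fun p => p.1 ⊔ p.2))) := by
        congr 2
        ext a
        simp only [Finset.coe_image, Finset.coe_product, Set.mem_image, Set.mem_prod, Prod.exists,
          Finset.mem_coe]
        constructor
        · rintro ⟨c, b, ⟨hc, hb⟩, rfl⟩
          exact ⟨b, c, ⟨hb, hc⟩, sup_comm b c⟩
        · rintro ⟨b, c, ⟨hb, hc⟩, rfl⟩
          exact ⟨c, b, ⟨hc, hb⟩, sup_comm c b⟩
      have := hzero C B hC0 hfB
      rwa [hswap] at this
    -- all generators of `B` are nonzero and supported on `T`: `(u^B) ⊆ (u_T)`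
    have hle : Ideal.span (uPow u '' ↑B) ≤ Ideal.span (u '' ↑T) := by
      rw [span_uPow_le_iff]
      intro b hb
      have hb' : b ∈ B := Finset.mem_coe.mp hb
      obtain ⟨l, hl⟩ : ∃ l, b l ≠ 0 := by
        by_contra hcon
        push Not at hcon
        exact hB0 ((funext hcon : b = 0) ▸ hb')
      have hlT : l ∈ T := by
        by_contra hlT
        exact hl (Nat.le_zero.mp (hex b (Finset.mem_union_left C hb') l hlT))
      obtain ⟨c, hc⟩ := dvd_uPow_of_pos u (Nat.pos_of_ne_zero hl)
      rw [hc]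
      exact Ideal.mul_mem_right _ _ (Ideal.subset_span ⟨l, Finset.mem_coe.mpr hlT, rfl⟩)
    have hfT : f ∈ Ideal.span (u '' ↑T) := by
      have heq : Ideal.span (u '' ↑T) ⊔ Ideal.span (uPow u '' ↑B) = Ideal.span (u '' ↑T) :=
        sup_eq_left.mpr hle
      rwa [heq] at hfB
    exact Ideal.mem_sup_left hfT
  · obtain ⟨b₀, hb₀, j, hjT, hj⟩ := hex
    set φ : (Fin N → ℕ) → (Fin N → ℕ) := fun b => if 0 < b j then b - Pi.single j 1 else b
      with hφ
    -- measures
    have m1 : ∑ b ∈ B.filter (fun b => b j = 0), ∑ l ∈ (insert j T)ᶜ, b l +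
        ∑ c ∈ C.filter (fun c => c j = 0), ∑ l ∈ (insert j T)ᶜ, c l < D := by
      rw [← hD]
      rcases Finset.mem_union.mp hb₀ with hb₀B | hb₀C
      · exact add_lt_add_of_lt_of_le (sum_filter_sum_compl_insert_lt T B hjT hb₀B hj)
          (sum_filter_sum_compl_insert_le T C j)
      · exact add_lt_add_of_le_of_lt (sum_filter_sum_compl_insert_le T B j)
          (sum_filter_sum_compl_insert_lt T C hjT hb₀C hj)
    have m2 : ∑ b ∈ B.image φ, ∑ l ∈ Tᶜ, b l + ∑ c ∈ C.image φ, ∑ l ∈ Tᶜ, c l < D := by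
      rw [← hD]
      rcases Finset.mem_union.mp hb₀ with hb₀B | hb₀C
      · exact add_lt_add_of_lt_of_le (sum_image_lower_sum_compl_lt T B hjT hb₀B hj)
          (sum_image_lower_sum_compl_le T C j)
      · exact add_lt_add_of_le_of_lt (sum_image_lower_sum_compl_le T B j)
          (sum_image_lower_sum_compl_lt T C hjT hb₀C hj)
    -- Step A: reduce modulo `u_j`
    have hA := ih _ m1 (insert j T) (B.filter (fun b => b j = 0)) (C.filter (fun c => c j = 0))
      rfl f (sup_span_uPow_le_insert_filter u T B j hfB) (sup_span_uPow_le_insert_filter u T C j hfC)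
    -- the sups of the filtered families are sups of the original ones
    have hsub : ∀ (B C : Finset (Fin N → ℕ)),
        (↑(((B.filter (fun b => b j = 0)) ×ˢ (C.filter (fun c => c j = 0))).image
          (fun p => p.1 ⊔ p.2)) : Set (Fin N → ℕ)) ⊆
          ↑((B ×ˢ C).image (fun p => p.1 ⊔ p.2)) := by
      intro B C a ha
      obtain ⟨p, hp, rfl⟩ := Finset.mem_image.mp (Finset.mem_coe.mp ha)
      obtain ⟨hp1, hp2⟩ := Finset.mem_product.mp hp
      exact Finset.mem_coe.mpr (Finset.mem_image.mpr ⟨p, Finset.mem_product.mpr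
        ⟨(Finset.mem_filter.mp hp1).1, (Finset.mem_filter.mp hp2).1⟩, rfl⟩)
    have hA' : f ∈ Ideal.span {u j} ⊔ (Ideal.span (u '' ↑T) ⊔
        Ideal.span (uPow u '' ↑(((B.filter (fun b => b j = 0)) ×ˢ
          (C.filter (fun c => c j = 0))).image (fun p => p.1 ⊔ p.2)))) := by
      rwa [Finset.coe_insert, Set.image_insert_eq, Ideal.span_insert, sup_assoc] at hA
    obtain ⟨v, hv, f'', hf'', hvf⟩ := Submodule.mem_sup.mp hA'
    obtain ⟨f', rfl⟩ := Ideal.mem_span_singleton'.mp hv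
    have hf''BC : f'' ∈ Ideal.span (u '' ↑T) ⊔
        Ideal.span (uPow u '' ↑((B ×ˢ C).image (fun p => p.1 ⊔ p.2))) := by
      have hle : Ideal.span (u '' ↑T) ⊔ Ideal.span (uPow u '' ↑(((B.filter (fun b => b j = 0)) ×ˢ
          (C.filter (fun c => c j = 0))).image (fun p => p.1 ⊔ p.2))) ≤ Ideal.span (u '' ↑T) ⊔
            Ideal.span (uPow u '' ↑((B ×ˢ C).image (fun p => p.1 ⊔ p.2))) :=
        sup_le_sup_left (Ideal.span_mono (Set.image_mono (hsub B C))) _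
      exact hle hf''
    -- `f''` lies in both ideals, hence so does `u_j f'`
    have hBC_le_B : Ideal.span (u '' ↑T) ⊔
        Ideal.span (uPow u '' ↑((B ×ˢ C).image (fun p => p.1 ⊔ p.2))) ≤
          Ideal.span (u '' ↑T) ⊔ Ideal.span (uPow u '' ↑B) := by
      refine sup_le_sup_left (span_uPow_mono_of_forall_exists_le u fun a ha => ?_) _
      obtain ⟨p, hp, rfl⟩ := Finset.mem_image.mp (Finset.mem_coe.mp ha)
      exact ⟨p.1, Finset.mem_coe.mpr (Finset.mem_product.mp hp).1, le_sup_left⟩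
    have hBC_le_C : Ideal.span (u '' ↑T) ⊔
        Ideal.span (uPow u '' ↑((B ×ˢ C).image (fun p => p.1 ⊔ p.2))) ≤
          Ideal.span (u '' ↑T) ⊔ Ideal.span (uPow u '' ↑C) := by
      refine sup_le_sup_left (span_uPow_mono_of_forall_exists_le u fun a ha => ?_) _
      obtain ⟨p, hp, rfl⟩ := Finset.mem_image.mp (Finset.mem_coe.mp ha)
      exact ⟨p.2, Finset.mem_coe.mpr (Finset.mem_product.mp hp).2, le_sup_right⟩
    have hjf'B : u j * f' ∈ Ideal.span (u '' ↑T) ⊔ Ideal.span (uPow u '' ↑B) := by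
      have : u j * f' = f - f'' := by rw [← hvf]; ring
      rw [this]
      exact sub_mem hfB (hBC_le_B hf''BC)
    have hjf'C : u j * f' ∈ Ideal.span (u '' ↑T) ⊔ Ideal.span (uPow u '' ↑C) := by
      have : u j * f' = f - f'' := by rw [← hvf]; ring
      rw [this]
      exact sub_mem hfC (hBC_le_C hf''BC)
    -- Step B: colon by `u_j` and induction for the lowered families
    have hf'B := (mul_mem_sup_span_uPow_iff u H T B hjT).mp hjf'B
    have hf'C := (mul_mem_sup_span_uPow_iff u H T C hjT).mp hjf'C
    have hD' := ih _ m2 T (B.image φ) (C.image φ) rfl f' hf'B hf'C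
    -- Step C: `u_j · (u^{φ b ⊔ φ c}) ∈ (u^{b ⊔ c})`
    have hjf' : u j * f' ∈ Ideal.span (u '' ↑T) ⊔
        Ideal.span (uPow u '' ↑((B ×ˢ C).image (fun p => p.1 ⊔ p.2))) := by
      refine mul_mem_of_forall_mem_sup_span (fun g hg => ?_) (fun g hg => ?_) hD'
      · exact Ideal.mem_sup_left (Ideal.mul_mem_left _ _ (Ideal.subset_span hg))
      · obtain ⟨a, ha, rfl⟩ := hg
        obtain ⟨p, hp, rfl⟩ := Finset.mem_image.mp (Finset.mem_coe.mp ha)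
        obtain ⟨hp1, hp2⟩ := Finset.mem_product.mp hp
        obtain ⟨b, hb, hb1⟩ := Finset.mem_image.mp hp1
        obtain ⟨c, hc, hc2⟩ := Finset.mem_image.mp hp2
        refine Ideal.mem_sup_right ?_
        rw [← uPow_single u j, ← uPow_add]
        refine uPow_mem_span_uPow_of_le u (b := b ⊔ c) (Finset.mem_coe.mpr
          (Finset.mem_image.mpr ⟨(b, c), Finset.mem_product.mpr ⟨hb, hc⟩, rfl⟩)) fun l => ?_
        rw [← hb1, ← hc2]
        simp only [Pi.add_apply, Pi.sup_apply, hφ]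
        by_cases hl : l = j
        · subst hl
          by_cases hbl : 0 < b l <;> by_cases hcl : 0 < c l <;>
            simp only [if_pos, if_neg, hbl, hcl, Pi.sub_apply, Pi.single_eq_same,
              not_false_eq_true] <;> omega
        · by_cases hbl : 0 < b j <;> by_cases hcl : 0 < c j <;>
            simp [hbl, hcl, hl]
    rw [← hvf, mul_comm]
    exact add_mem hjf' hf''BC

/-- **Intersection of monomial ideals** (general sets of exponents):
`(u^b : b ∈ B) ∩ (u^c : c ∈ C) = (u^{b ⊔ c} : b ∈ B, c ∈ C)`. [folklore] -/
theorem span_uPow_inf_span_uPow (u : Fin N → S)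
    (H : ∀ (i : Fin N) (T : Finset (Fin N)), i ∉ T →
      ∀ y, u i * y ∈ Ideal.span (u '' ↑T) → y ∈ Ideal.span (u '' ↑T))
    (B C : Set (Fin N → ℕ)) :
    Ideal.span (uPow u '' B) ⊓ Ideal.span (uPow u '' C) =
      Ideal.span (uPow u '' Set.image2 (· ⊔ ·) B C) := by
  classical
  apply le_antisymm
  swap
  · refine le_inf (span_uPow_mono_of_forall_exists_le u fun a ha => ?_)
      (span_uPow_mono_of_forall_exists_le u fun a ha => ?_)
    · obtain ⟨b, hb, c, _, rfl⟩ := ha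
      exact ⟨b, hb, le_sup_left⟩
    · obtain ⟨b, _, c, hc, rfl⟩ := ha
      exact ⟨c, hc, le_sup_right⟩
  obtain ⟨B₀, hB₀, hBle, hBeq⟩ := exists_finset_span_uPow_eq u B
  obtain ⟨C₀, hC₀, hCle, hCeq⟩ := exists_finset_span_uPow_eq u C
  have h := sup_span_uPow_inf_sup_span_uPow u H ∅ B₀ C₀
  rw [span_image_coe_empty_sup, span_image_coe_empty_sup, span_image_coe_empty_sup] at h
  rw [hBeq, hCeq, h]
  refine Ideal.span_mono (Set.image_mono fun a ha => ?_)
  obtain ⟨p, hp, rfl⟩ := Finset.mem_image.mp (Finset.mem_coe.mp ha)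
  obtain ⟨hp1, hp2⟩ := Finset.mem_product.mp hp
  exact ⟨p.1, hB₀ (Finset.mem_coe.mpr hp1), p.2, hC₀ (Finset.mem_coe.mpr hp2), rfl⟩

/-- **Finite intersections of monomial ideals are monomial**: if `f ∈ (u^b : b ∈ B_i)` for all
`i ∈ s` then `f ∈ (u^c : c above some element of each B_i)`. [folklore] -/
theorem mem_span_uPow_setOf_forall_exists_le (u : Fin N → S)
    (H : ∀ (i : Fin N) (T : Finset (Fin N)), i ∉ T →
      ∀ y, u i * y ∈ Ideal.span (u '' ↑T) → y ∈ Ideal.span (u '' ↑T))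
    {ι : Type*} (s : Finset ι) (B : ι → Set (Fin N → ℕ)) {f : S}
    (hf : ∀ i ∈ s, f ∈ Ideal.span (uPow u '' B i)) :
    f ∈ Ideal.span (uPow u '' {c | ∀ i ∈ s, ∃ b ∈ B i, b ≤ c}) := by
  classical
  induction s using Finset.induction_on with
  | empty =>
    have h1 : (1 : S) ∈ Ideal.span (uPow u '' {c : Fin N → ℕ | ∀ i ∈ (∅ : Finset ι), ∃ b ∈ B i, b ≤ c}) := by
      have := uPow_mem_span_uPow u (B := {c : Fin N → ℕ | ∀ i ∈ (∅ : Finset ι), ∃ b ∈ B i, b ≤ c})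
        (b := 0) (by simp)
      rwa [uPow_zero] at this
    rw [(Ideal.eq_top_iff_one _).mpr h1]
    trivial
  | insert i s his ih =>
    have hfi : f ∈ Ideal.span (uPow u '' B i) := hf i (Finset.mem_insert_self i s)
    have hfs := ih fun i' hi' => hf i' (Finset.mem_insert_of_mem hi')
    have hmem : f ∈ Ideal.span (uPow u '' B i) ⊓
        Ideal.span (uPow u '' {c | ∀ i' ∈ s, ∃ b ∈ B i', b ≤ c}) := ⟨hfi, hfs⟩
    rw [span_uPow_inf_span_uPow u H] at hmem
    refine span_uPow_mono_of_forall_exists_le u (fun a ha => ?_) hmem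
    obtain ⟨b, hb, c, hc, rfl⟩ := ha
    refine ⟨b ⊔ c, fun i' hi' => ?_, le_rfl⟩
    rcases Finset.mem_insert.mp hi' with rfl | hi's
    · exact ⟨b, hb, le_sup_left⟩
    · obtain ⟨b', hb', hb'c⟩ := hc i' hi's
      exact ⟨b', hb', hb'c.trans le_sup_right⟩

/-! ## Powers of `(u)` as monomial ideals -/

/-- `I_α(a)` is the monomial ideal of the exponents of weight `≥ a`.
[cite: CossartPiltant2019, Ch. 2 (arXiv v1 p. 9)] -/
theorem monomialIdeal_eq_span_image (u : Fin N → S) (α : Fin N → ℝ) (a : ℝ) :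
    monomialIdeal u α a = Ideal.span (uPow u '' {x | a ≤ weight α x}) := by
  unfold monomialIdeal
  congr 1
  ext m
  simp only [Set.mem_setOf_eq, Set.mem_image]
  exact ⟨fun ⟨x, hx, hm⟩ => ⟨x, hx, hm.symm⟩, fun ⟨x, hx, hm⟩ => ⟨x, hx, hm.symm⟩⟩

/-- `(u)ᵏ = (u^c : |c| ≥ k)`. [folklore] -/
theorem span_range_pow_eq_span_uPow (u : Fin N → S) (k : ℕ) :
    Ideal.span (Set.range u) ^ k = Ideal.span (uPow u '' {c | k ≤ ∑ l, c l}) := by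
  rw [← monomialIdeal_one_natCast (u := u) rfl k, monomialIdeal_eq_span_image]
  congr 2
  ext c
  simp only [Set.mem_setOf_eq, weight_one]
  exact_mod_cast Iff.rfl

/-! ## Cossart–Piltant 2019, Prop. 2.1: the minimal monomial ideal `I(f)` and the set `𝐒(f)` -/

/-- **Cossart–Piltant 2019, Prop. 2.1 (existence)**, for a Noetherian local ring `S` and
`u₁, …, u_N ∈ m_S` satisfying (H) (e.g. part of a regular system of parameters of a regular local
ring): every `f ∈ S` lies in a *smallest* monomial ideal, generated by the monomials of a finite
antichain `𝐒(f) ⊂ ℕ^N`: `f ∈ (u^a : a ∈ 𝐒(f))`, and whenever `f ∈ (u^b : b ∈ B)` every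
`a ∈ 𝐒(f)` lies above some `b ∈ B`.  (The paper proves this by passing to the completion; here:
finite intersections of monomial ideals are monomial, Dickson's lemma, and Krull's intersection
theorem in `S/(u^a : a ∈ 𝐒(f))`.) [cite: CossartPiltant2019, Prop. 2.1 (arXiv v1 p. 10)] -/
theorem exists_minimal_span_uPow [IsNoetherianRing S] [IsLocalRing S] (u : Fin N → S)
    (H : ∀ (i : Fin N) (T : Finset (Fin N)), i ∉ T →
      ∀ y, u i * y ∈ Ideal.span (u '' ↑T) → y ∈ Ideal.span (u '' ↑T))
    (hu : ∀ i, u i ∈ maximalIdeal S) (f : S) :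
    ∃ A : Finset (Fin N → ℕ), IsAntichain (· ≤ ·) (↑A : Set (Fin N → ℕ)) ∧
      f ∈ Ideal.span (uPow u '' ↑A) ∧
      ∀ B : Set (Fin N → ℕ), f ∈ Ideal.span (uPow u '' B) → ∀ a ∈ A, ∃ b ∈ B, b ≤ a := by
  classical
  -- the upper set of exponents lying above a generator of every monomial ideal containing `f`
  set U : Set (Fin N → ℕ) :=
    {c | ∀ B : Set (Fin N → ℕ), f ∈ Ideal.span (uPow u '' B) → ∃ b ∈ B, b ≤ c} with hU
  have hpwo : U.IsPWO := Set.isPWO_of_wellQuasiOrderedLE U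
  have hfin : {a | Minimal (· ∈ U) a}.Finite :=
    (setOf_minimal_antichain (· ∈ U)).finite_of_partiallyWellOrderedOn
      (hpwo.mono (setOf_minimal_subset U))
  set A := hfin.toFinset with hA
  have hAco : (↑A : Set (Fin N → ℕ)) = {a | Minimal (· ∈ U) a} := by rw [hA, Set.Finite.coe_toFinset]
  have hAU : ∀ c ∈ U, ∃ a ∈ A, a ≤ c := fun c hc => by
    obtain ⟨a, hac, ha⟩ := hpwo.exists_le_minimal hc
    exact ⟨a, hfin.mem_toFinset.mpr ha, hac⟩
  refine ⟨A, hAco ▸ setOf_minimal_antichain (· ∈ U), ?_, fun B hB a ha => ?_⟩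
  swap
  · exact (hfin.mem_toFinset.mp ha).prop B hB
  -- `f ∈ (u^A)`: by Krull it suffices that `f ∈ (u^A) + 𝔪ᵏ` for all `k`
  set 𝔫 : Ideal S := Ideal.span (Set.range u) with h𝔫
  have h𝔫le : 𝔫 ≤ maximalIdeal S := by
    rw [h𝔫, Ideal.span_le]
    rintro _ ⟨i, rfl⟩
    exact hu i
  suffices hk : ∀ k : ℕ, f ∈ Ideal.span (uPow u '' ↑A) ⊔ 𝔫 ^ k by
    by_cases htop : Ideal.span (uPow u '' ↑A) = ⊤
    · rw [htop]; trivial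
    have hx : Ideal.Quotient.mk (Ideal.span (uPow u '' ↑A)) f ∈
        ⨅ k : ℕ, ((maximalIdeal S).map (Ideal.Quotient.mk (Ideal.span (uPow u '' ↑A)))) ^ k := by
      refine Ideal.mem_iInf.mpr fun k => ?_
      rw [← Ideal.map_pow]
      have h1 : Ideal.Quotient.mk (Ideal.span (uPow u '' ↑A)) f ∈
          (Ideal.span (uPow u '' ↑A) ⊔ maximalIdeal S ^ k).map
            (Ideal.Quotient.mk (Ideal.span (uPow u '' ↑A))) :=
        Ideal.mem_map_of_mem _ (sup_le_sup_left (Ideal.pow_right_mono h𝔫le k) _ (hk k))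
      rwa [Ideal.map_sup, Ideal.map_quotient_self, bot_sup_eq] at h1
    haveI : Nontrivial (S ⧸ Ideal.span (uPow u '' ↑A)) := Ideal.Quotient.nontrivial_iff.mpr htop
    haveI : IsLocalRing (S ⧸ Ideal.span (uPow u '' ↑A)) :=
      IsLocalRing.of_surjective' (Ideal.Quotient.mk _) Ideal.Quotient.mk_surjective
    have hne : (maximalIdeal S).map (Ideal.Quotient.mk (Ideal.span (uPow u '' ↑A))) ≠ ⊤ := by
      intro htop'
      have h1 : (1 : S ⧸ Ideal.span (uPow u '' ↑A)) ∈
          (maximalIdeal S).map (Ideal.Quotient.mk (Ideal.span (uPow u '' ↑A))) := by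
        rw [htop']; trivial
      obtain ⟨x, hx, hx1⟩ :=
        (Ideal.mem_map_iff_of_surjective _ Ideal.Quotient.mk_surjective).mp h1
      have h2 : Ideal.Quotient.mk (Ideal.span (uPow u '' ↑A)) x =
          Ideal.Quotient.mk (Ideal.span (uPow u '' ↑A)) 1 := by rw [hx1, map_one]
      have h3 : x - 1 ∈ maximalIdeal S := le_maximalIdeal htop (Ideal.Quotient.eq.mp h2)
      have h4 : (1 : S) ∈ maximalIdeal S := by simpa using sub_mem hx h3
      exact (maximalIdeal.isMaximal S).ne_top ((Ideal.eq_top_iff_one _).mpr h4)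
    rw [Ideal.iInf_pow_eq_bot_of_isLocalRing _ hne, Ideal.mem_bot, Ideal.Quotient.eq_zero_iff_mem] at hx
    exact hx
  intro k
  -- the finite family of small monomial ideals containing `f` modulo `𝔫ᵏ`
  set box : Finset (Fin N → ℕ) := Fintype.piFinset fun _ : Fin N => Finset.range k with hbox
  set V : Set (Fin N → ℕ) := {c | k ≤ ∑ l, c l} with hV
  have h𝔫k : 𝔫 ^ k = Ideal.span (uPow u '' V) := span_range_pow_eq_span_uPow u k
  set 𝓒 : Finset (Finset (Fin N → ℕ)) :=
    box.powerset.filter (fun C => f ∈ Ideal.span (uPow u '' ↑C) ⊔ 𝔫 ^ k) with h𝓒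
  have hf𝓒 : ∀ C ∈ 𝓒, f ∈ Ideal.span (uPow u '' (↑C ∪ V)) := by
    intro C hC
    rw [Set.image_union, Ideal.span_union, ← h𝔫k]
    exact (Finset.mem_filter.mp hC).2
  have hW := mem_span_uPow_setOf_forall_exists_le u H 𝓒 (fun C => (↑C ∪ V)) hf𝓒
  refine (span_uPow_le_iff u).mpr (fun c hc => ?_) hW
  by_cases hck : k ≤ ∑ l, c l
  · refine Ideal.mem_sup_right ?_
    rw [h𝔫k]
    exact uPow_mem_span_uPow u hck
  -- `c` is small: it lies in `U`, hence above an element of `A`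
  push Not at hck
  have hcU : c ∈ U := by
    intro B hB
    set C : Finset (Fin N → ℕ) := box.filter (fun b => b ∈ B) with hC
    have hC𝓒 : C ∈ 𝓒 := by
      refine Finset.mem_filter.mpr ⟨Finset.mem_powerset.mpr (Finset.filter_subset _ _), ?_⟩
      refine (span_uPow_le_iff u).mpr (fun b hb => ?_) hB
      by_cases hbk : k ≤ ∑ l, b l
      · refine Ideal.mem_sup_right ?_
        rw [h𝔫k]
        exact uPow_mem_span_uPow u hbk
      · refine Ideal.mem_sup_left (uPow_mem_span_uPow u (Finset.mem_coe.mpr ?_))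
        refine Finset.mem_filter.mpr ⟨Fintype.mem_piFinset.mpr fun l => Finset.mem_range.mpr ?_, hb⟩
        push Not at hbk
        exact lt_of_le_of_lt (Finset.single_le_sum (f := fun l => b l) (fun _ _ => Nat.zero_le _)
          (Finset.mem_univ l)) hbk
    obtain ⟨b, hb, hbc⟩ := hc C hC𝓒
    rcases hb with hb | hb
    · exact ⟨b, (Finset.mem_filter.mp (Finset.mem_coe.mp hb)).2, hbc⟩
    · exfalso
      have : ∑ l, b l ≤ ∑ l, c l := Finset.sum_le_sum fun l _ => hbc l
      exact absurd (hb.trans this) (not_le.mpr hck)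
  obtain ⟨a, ha, hac⟩ := hAU c hcU
  exact Ideal.mem_sup_left (uPow_mem_span_uPow_of_le u (Finset.mem_coe.mpr ha) hac)

/-- **Prop. 2.1 (uniqueness of `𝐒(f)`)**: two antichains each of which refines the other are
equal; in particular the antichain of `exists_minimal_span_uPow` is unique.
[cite: CossartPiltant2019, Prop. 2.1 (arXiv v1 p. 10)] -/
theorem antichain_unique_of_forall_exists_le {A A' : Finset (Fin N → ℕ)}
    (hA : IsAntichain (· ≤ ·) (↑A : Set (Fin N → ℕ)))
    (hA' : IsAntichain (· ≤ ·) (↑A' : Set (Fin N → ℕ)))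
    (h : ∀ a ∈ A, ∃ a' ∈ A', a' ≤ a) (h' : ∀ a' ∈ A', ∃ a ∈ A, a ≤ a') : A = A' := by
  have key : ∀ {A A' : Finset (Fin N → ℕ)}, IsAntichain (· ≤ ·) (↑A : Set (Fin N → ℕ)) →
      (∀ a ∈ A, ∃ a' ∈ A', a' ≤ a) → (∀ a' ∈ A', ∃ a ∈ A, a ≤ a') → A ⊆ A' := by
    intro A A' hA h h' a ha
    obtain ⟨a', ha', ha'a⟩ := h a ha
    obtain ⟨a'', ha'', ha''a'⟩ := h' a' ha'
    have : a'' = a := by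
      by_contra hne
      exact hA (Finset.mem_coe.mpr ha'') (Finset.mem_coe.mpr ha) hne (ha''a'.trans ha'a)
    subst this
    have : a' = a'' := le_antisymm ha'a ha''a'
    subst this
    exact ha'
  exact Finset.Subset.antisymm (key hA h h') (key hA' h' h)

/-- **Prop. 2.1 (ii)**: in any expansion `f = ∑_{a ∈ 𝐒(f)} γ_a u^a` over the minimal antichain,
no coefficient lies in `(u₁, …, u_N)`. [cite: CossartPiltant2019, Prop. 2.1 (ii) (arXiv v1 p. 10)] -/
theorem coeff_not_mem_of_minimal (u : Fin N → S) {f : S} {A : Finset (Fin N → ℕ)}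
    (hA : IsAntichain (· ≤ ·) (↑A : Set (Fin N → ℕ)))
    (hmin : ∀ B : Set (Fin N → ℕ), f ∈ Ideal.span (uPow u '' B) → ∀ a ∈ A, ∃ b ∈ B, b ≤ a)
    {γ : (Fin N → ℕ) → S} (hf : f = ∑ a ∈ A, γ a * uPow u a) :
    ∀ a ∈ A, γ a ∉ Ideal.span (Set.range u) := by
  classical
  intro a₀ ha₀ hγ
  -- `γ_{a₀} u^{a₀} ∈ (u^{a₀ + e_l} : l)`, so `f` lies in the monomial ideal of
  -- `B = (A ∖ {a₀}) ∪ {a₀ + e_l}`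
  set B : Set (Fin N → ℕ) := ↑(A.erase a₀) ∪ Set.range (fun l : Fin N => a₀ + Pi.single l 1)
    with hB
  have hfB : f ∈ Ideal.span (uPow u '' B) := by
    rw [hf, ← Finset.add_sum_erase A _ ha₀]
    refine add_mem ?_ (Submodule.sum_mem _ fun a ha => Ideal.mul_mem_left _ _
      (uPow_mem_span_uPow u (Or.inl (Finset.mem_coe.mpr ha))))
    obtain ⟨c, hc⟩ := Ideal.mem_span_range_iff_exists_fun.mp hγ
    rw [← hc, Finset.sum_mul]
    refine Submodule.sum_mem _ fun l _ => ?_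
    rw [mul_assoc, ← uPow_single u l, ← uPow_add, add_comm (Pi.single l 1)]
    exact Ideal.mul_mem_left _ _ (uPow_mem_span_uPow u (Or.inr ⟨l, rfl⟩))
  obtain ⟨b, hb, hba⟩ := hmin B hfB a₀ ha₀
  rcases hb with hb | ⟨l, rfl⟩
  · have hb' := Finset.mem_erase.mp (Finset.mem_coe.mp hb)
    exact hA (Finset.mem_coe.mpr hb'.2) (Finset.mem_coe.mpr ha₀) hb'.1 hba
  · have := hba l
    simp only [Pi.add_apply, Pi.single_eq_same] at this
    omega

/-- **Prop. 2.1, converse**: an expansion `f = ∑_{a ∈ A} γ_a u^a` over an antichain `A` with all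
`γ_a ∉ (u₁, …, u_N)` exhibits `A` as `𝐒(f)`: every monomial ideal containing `f` contains the
`u^a`, `a ∈ A` (colon formula: `γ_{a₀} ∈ ((u^e : e ∈ E) : u^{a₀}) = (u^{e ∸ a₀}) ⊆ (u)`).
[cite: CossartPiltant2019, Prop. 2.1 (arXiv v1 p. 10)] -/
theorem minimal_of_coeff_not_mem (u : Fin N → S)
    (H : ∀ (i : Fin N) (T : Finset (Fin N)), i ∉ T →
      ∀ y, u i * y ∈ Ideal.span (u '' ↑T) → y ∈ Ideal.span (u '' ↑T))
    {f : S} {A : Finset (Fin N → ℕ)} (hA : IsAntichain (· ≤ ·) (↑A : Set (Fin N → ℕ)))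
    {γ : (Fin N → ℕ) → S} (hγ : ∀ a ∈ A, γ a ∉ Ideal.span (Set.range u))
    (hf : f = ∑ a ∈ A, γ a * uPow u a) :
    ∀ B : Set (Fin N → ℕ), f ∈ Ideal.span (uPow u '' B) → ∀ a ∈ A, ∃ b ∈ B, b ≤ a := by
  classical
  intro B hfB a₀ ha₀
  by_contra hno
  push Not at hno
  set E : Set (Fin N → ℕ) := B ∪ ↑(A.erase a₀) with hE
  have hmem : uPow u a₀ * γ a₀ ∈ Ideal.span (uPow u '' E) := by
    have : uPow u a₀ * γ a₀ = f - ∑ a ∈ A.erase a₀, γ a * uPow u a := by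
      rw [hf, ← Finset.add_sum_erase A _ ha₀]
      ring
    rw [this]
    refine sub_mem (Ideal.span_mono (Set.image_mono Set.subset_union_left) hfB) ?_
    exact Submodule.sum_mem _ fun a ha => Ideal.mul_mem_left _ _
      (uPow_mem_span_uPow u (Or.inr (Finset.mem_coe.mpr ha)))
  rw [uPow_mul_mem_span_uPow_iff u H E a₀] at hmem
  refine hγ a₀ ha₀ ((span_uPow_le_iff u).mpr (fun d hd => ?_) hmem)
  obtain ⟨e, he, rfl⟩ := hd
  have hne : ¬ e ≤ a₀ := by
    rcases he with he | he
    · exact hno e he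
    · have he' := Finset.mem_erase.mp (Finset.mem_coe.mp he)
      exact fun hle => hA (Finset.mem_coe.mpr he'.2) (Finset.mem_coe.mpr ha₀) he'.1 hle
  obtain ⟨l, hl⟩ : ∃ l, ¬ e l ≤ a₀ l := by
    by_contra hcon
    push Not at hcon
    exact hne hcon
  obtain ⟨c, hc⟩ := dvd_uPow_of_pos u (b := e - a₀) (j := l) (by simp only [Pi.sub_apply]; omega)
  rw [hc]
  exact Ideal.mul_mem_right _ _ (Ideal.subset_span (Set.mem_range_self l))

/-- `𝐒(f) = ∅ ⟺ f = 0` (cf. Remark 2.1: `Δ = ∅ ⟺ h = X^m`). [cite: CossartPiltant2019, Prop. 2.1 (arXiv v1 p. 10)] -/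
theorem eq_empty_iff_eq_zero_of_minimal (u : Fin N → S) {f : S} {A : Finset (Fin N → ℕ)}
    (hfA : f ∈ Ideal.span (uPow u '' ↑A))
    (hmin : ∀ B : Set (Fin N → ℕ), f ∈ Ideal.span (uPow u '' B) → ∀ a ∈ A, ∃ b ∈ B, b ≤ a) :
    A = ∅ ↔ f = 0 := by
  constructor
  · rintro rfl
    simpa using hfA
  · rintro rfl
    by_contra hne
    obtain ⟨a, ha⟩ := Finset.nonempty_iff_ne_empty.mpr hne
    obtain ⟨b, hb, -⟩ := hmin ∅ (by simp) a ha
    exact hb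

/-! ## The monomial valuations `μ_α` (v1 p. 9) on monomials and via `𝐒(f)` -/

/-- `|·|_α` is monotone for a nonnegative weight vector. [cite: CossartPiltant2019, Ch. 2 (arXiv v1 p. 9)] -/
theorem weight_mono {α : Fin N → ℝ} (hα : ∀ j, 0 ≤ α j) {x y : Fin N → ℕ} (h : x ≤ y) :
    weight α x ≤ weight α y := by
  unfold weight
  exact Finset.sum_le_sum fun j _ => mul_le_mul_of_nonneg_left (by exact_mod_cast h j) (hα j)

/-- **`u^x ∈ I_α(a) ⟺ a ≤ |x|_α`** for `α ≥ 0` (and `(u) ≠ S`). [cite: CossartPiltant2019, Ch. 2 (arXiv v1 p. 9)] -/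
theorem uPow_mem_monomialIdeal_iff (u : Fin N → S)
    (H : ∀ (i : Fin N) (T : Finset (Fin N)), i ∉ T →
      ∀ y, u i * y ∈ Ideal.span (u '' ↑T) → y ∈ Ideal.span (u '' ↑T))
    (hu : Ideal.span (Set.range u) ≠ ⊤) {α : Fin N → ℝ} (hα : ∀ j, 0 ≤ α j) {a : ℝ}
    {x : Fin N → ℕ} : uPow u x ∈ monomialIdeal u α a ↔ a ≤ weight α x := by
  rw [monomialIdeal_eq_span_image, uPow_mem_span_uPow_iff u H hu]
  exact ⟨fun ⟨b, hb, hbx⟩ => le_trans hb (weight_mono hα hbx), fun h => ⟨x, h, le_rfl⟩⟩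

/-- **`μ_α(u^x) = |x|_α`** for `α ≥ 0`: the monomial valuation of a monomial is its weight.
[cite: CossartPiltant2019, Ch. 2 (arXiv v1 p. 9)] -/
theorem monomialVal_uPow (u : Fin N → S)
    (H : ∀ (i : Fin N) (T : Finset (Fin N)), i ∉ T →
      ∀ y, u i * y ∈ Ideal.span (u '' ↑T) → y ∈ Ideal.span (u '' ↑T))
    (hu : Ideal.span (Set.range u) ≠ ⊤) {α : Fin N → ℝ} (hα : ∀ j, 0 ≤ α j) (x : Fin N → ℕ) :
    monomialVal u α (uPow u x) = (weight α x : EReal) := by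
  apply le_antisymm
  · refine sSup_le fun r hr => ?_
    obtain ⟨a, ha, rfl⟩ := hr
    exact EReal.coe_le_coe_iff.mpr ((uPow_mem_monomialIdeal_iff u H hu hα).mp ha)
  · exact le_monomialVal_of_mem (uPow_mem_monomialIdeal u le_rfl)

/-- **`f ∈ I_α(a) ⟺ a ≤ |x|_α` for all `x ∈ 𝐒(f)`** (`α ≥ 0`): membership of `f` in the
monomial filtration is read off the minimal antichain of Prop. 2.1, i.e.
`μ_α(f) = min_{x ∈ 𝐒(f)} |x|_α`. [cite: CossartPiltant2019, Ch. 2 (arXiv v1 pp. 9–10)] -/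
theorem mem_monomialIdeal_iff_of_minimal (u : Fin N → S) {α : Fin N → ℝ} (hα : ∀ j, 0 ≤ α j)
    {f : S} {A : Finset (Fin N → ℕ)} (hfA : f ∈ Ideal.span (uPow u '' ↑A))
    (hmin : ∀ B : Set (Fin N → ℕ), f ∈ Ideal.span (uPow u '' B) → ∀ a ∈ A, ∃ b ∈ B, b ≤ a)
    {a : ℝ} : f ∈ monomialIdeal u α a ↔ ∀ x ∈ A, a ≤ weight α x := by
  rw [monomialIdeal_eq_span_image]
  constructor
  · intro h x hx
    obtain ⟨b, hb, hbx⟩ := hmin _ h x hx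
    exact le_trans hb (weight_mono hα hbx)
  · intro h
    exact (span_uPow_le_iff u).mpr (fun x hx => uPow_mem_span_uPow u (h x hx)) hfA

/-- **`μ_α(f) = min_{x ∈ 𝐒(f)} |x|_α`** for `f ≠ 0` (`𝐒(f) ≠ ∅`) and `α ≥ 0`.
[cite: CossartPiltant2019, Ch. 2 (arXiv v1 pp. 9–10)] -/
theorem monomialVal_eq_inf'_of_minimal (u : Fin N → S) {α : Fin N → ℝ} (hα : ∀ j, 0 ≤ α j)
    {f : S} {A : Finset (Fin N → ℕ)} (hfA : f ∈ Ideal.span (uPow u '' ↑A))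
    (hmin : ∀ B : Set (Fin N → ℕ), f ∈ Ideal.span (uPow u '' B) → ∀ a ∈ A, ∃ b ∈ B, b ≤ a)
    (hA : A.Nonempty) :
    monomialVal u α f = ((A.inf' hA (weight α) : ℝ) : EReal) := by
  apply le_antisymm
  · refine sSup_le fun r hr => ?_
    obtain ⟨a, ha, rfl⟩ := hr
    exact EReal.coe_le_coe_iff.mpr ((Finset.le_inf'_iff hA _).mpr
      ((mem_monomialIdeal_iff_of_minimal u hα hfA hmin).mp ha))
  · refine le_monomialVal_of_mem ((mem_monomialIdeal_iff_of_minimal u hα hfA hmin).mpr ?_)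
    exact fun x hx => Finset.inf'_le _ hx

/-- Monomials `u^{e ∸ a₀}` with `e ≰ a₀` are proper monomials: `(u^{e ∸ a₀} : e ∈ E) ⊆ (u)` when no
`e ∈ E` lies below `a₀`. [folklore] -/
theorem span_uPow_tsub_le_span_range (u : Fin N → S) {E : Set (Fin N → ℕ)} {a₀ : Fin N → ℕ}
    (h : ∀ e ∈ E, ¬ e ≤ a₀) :
    Ideal.span (uPow u '' ((fun e => e - a₀) '' E)) ≤ Ideal.span (Set.range u) := by
  refine (span_uPow_le_iff u).mpr fun d hd => ?_
  obtain ⟨e, he, rfl⟩ := hd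
  obtain ⟨l, hl⟩ : ∃ l, ¬ e l ≤ a₀ l := by
    by_contra hcon
    push Not at hcon
    exact h e he hcon
  obtain ⟨c, hc⟩ := dvd_uPow_of_pos u (b := e - a₀) (j := l) (by simp only [Pi.sub_apply]; omega)
  rw [hc]
  exact Ideal.mul_mem_right _ _ (Ideal.subset_span (Set.mem_range_self l))

/-- **Prop. 2.1, well-definedness of the coefficient classes** ("the class `γ(f, a) + I_J` is
independent of the chosen expansion"): two expansions of the same element over one antichain
have coefficients congruent modulo `(u₁, …, u_N)`.
[cite: CossartPiltant2019, Prop. 2.1, proof (arXiv v1 p. 10)] -/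
theorem coeff_sub_coeff_mem_of_antichain (u : Fin N → S)
    (H : ∀ (i : Fin N) (T : Finset (Fin N)), i ∉ T →
      ∀ y, u i * y ∈ Ideal.span (u '' ↑T) → y ∈ Ideal.span (u '' ↑T))
    {A : Finset (Fin N → ℕ)} (hA : IsAntichain (· ≤ ·) (↑A : Set (Fin N → ℕ)))
    {γ γ' : (Fin N → ℕ) → S} (h : ∑ a ∈ A, γ a * uPow u a = ∑ a ∈ A, γ' a * uPow u a) :
    ∀ a ∈ A, γ a - γ' a ∈ Ideal.span (Set.range u) := by
  classical
  intro a₀ ha₀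
  have hmem : uPow u a₀ * (γ a₀ - γ' a₀) ∈ Ideal.span (uPow u '' ↑(A.erase a₀)) := by
    have hzero : ∑ a ∈ A, (γ a - γ' a) * uPow u a = 0 := by
      simp only [sub_mul, Finset.sum_sub_distrib, h, sub_self]
    rw [← Finset.add_sum_erase A _ ha₀] at hzero
    have : uPow u a₀ * (γ a₀ - γ' a₀) = -∑ a ∈ A.erase a₀, (γ a - γ' a) * uPow u a := by
      rw [mul_comm]
      exact eq_neg_of_add_eq_zero_left hzero
    rw [this]
    exact neg_mem (Submodule.sum_mem _ fun a ha => Ideal.mul_mem_left _ _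
      (uPow_mem_span_uPow u (Finset.mem_coe.mpr ha)))
  rw [uPow_mul_mem_span_uPow_iff u H _ a₀] at hmem
  refine span_uPow_tsub_le_span_range u (fun e he hle => ?_) hmem
  have he' := Finset.mem_erase.mp (Finset.mem_coe.mp he)
  exact hA (Finset.mem_coe.mpr he'.2) (Finset.mem_coe.mpr ha₀) he'.1 hle

/-! ## Transport of `𝐒(f)` under monomial substitutions (mechanism of Prop. 2.6) -/

/-- **Transport of expansions under a monomial substitution** (the mechanism of Prop. 2.6,
`l(Δ_S(h; u; Z)) = Δ_{S'}(h'; u'; Z')`, and of base changes): let `ψ : S → S'` map monomials to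
monomials, `ψ(u^a) = u'^{L a}` with `L` injective, and reflect `(u')` into `(u)`.  If
`f = Σ_{a ∈ A} γ_a u^a` is an expansion over an antichain `A` with all `γ_a ∉ (u)` (so `A = 𝐒(f)`),
then `ψ f` admits such an expansion over the antichain of minimal elements of `L(A)`; hence (by
`minimal_of_coeff_not_mem`) `𝐒(ψ f)` is the set of minimal elements of `L(𝐒(f))` — Cossart–Piltant's
"`(1/i) 𝐒(f_{i,Z'}) ⊆ l((1/i) 𝐒(f_{i,Z}))`". [cite: CossartPiltant2019, Prop. 2.6, proof (arXiv v1 p. 13)] -/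
theorem exists_expansion_map_of_expansion' {S' : Type*} [CommRing S'] {N' : ℕ} (ψ : S →+* S')
    (u : Fin N → S) (u' : Fin N' → S') (L : (Fin N → ℕ) → (Fin N' → ℕ))
    (hLinj : Function.Injective L) (hL : ∀ a, ψ (uPow u a) = uPow u' (L a))
    (hψ : ∀ γ : S, ψ γ ∈ Ideal.span (Set.range u') → γ ∈ Ideal.span (Set.range u))
    {f : S} {A : Finset (Fin N → ℕ)} {γ : (Fin N → ℕ) → S}
    (hγ : ∀ a ∈ A, γ a ∉ Ideal.span (Set.range u)) (hf : f = ∑ a ∈ A, γ a * uPow u a) :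
    ∃ (M : Finset (Fin N' → ℕ)) (γ' : (Fin N' → ℕ) → S'),
      IsAntichain (· ≤ ·) (↑M : Set (Fin N' → ℕ)) ∧ M ⊆ A.image L ∧
      (∀ c ∈ A.image L, ∃ m ∈ M, m ≤ c) ∧
      (∀ m ∈ M, γ' m ∉ Ideal.span (Set.range u')) ∧
      ψ f = ∑ m ∈ M, γ' m * uPow u' m ∧
      ∀ a ∈ A, L a ∈ M → γ' (L a) - ψ (γ a) ∈ Ideal.span (Set.range u') := by
  classical
  set C : Finset (Fin N' → ℕ) := A.image L with hC
  set M : Finset (Fin N' → ℕ) := C.filter (fun c => Minimal (· ∈ (↑C : Set (Fin N' → ℕ))) c) with hM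
  -- below every `c ∈ C` there is a minimal element `φ c ∈ M`
  have hpwo : (↑C : Set (Fin N' → ℕ)).IsPWO := Set.isPWO_of_wellQuasiOrderedLE _
  have hex : ∀ c ∈ C, ∃ m ∈ M, m ≤ c := by
    intro c hc
    obtain ⟨m, hmc, hm⟩ := hpwo.exists_le_minimal (Finset.mem_coe.mpr hc)
    exact ⟨m, Finset.mem_filter.mpr ⟨Finset.mem_coe.mp hm.prop, hm⟩, hmc⟩
  choose! φ hφM hφle using hex
  have hφid : ∀ m ∈ M, φ m = m := by
    intro m hm
    obtain ⟨hmC, hmin⟩ := Finset.mem_filter.mp hm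
    exact hmin.eq_of_le (Finset.mem_coe.mpr (Finset.mem_filter.mp (hφM m hmC)).1) (hφle m hmC)
  have hanti : IsAntichain (· ≤ ·) (↑M : Set (Fin N' → ℕ)) := by
    intro a ha b hb hne hle
    have ha' := Finset.mem_filter.mp (Finset.mem_coe.mp ha)
    have hb' := Finset.mem_filter.mp (Finset.mem_coe.mp hb)
    exact hne (hb'.2.eq_of_le (Finset.mem_coe.mpr ha'.1) hle)
  -- the regrouped coefficients
  set γ' : (Fin N' → ℕ) → S' := fun m =>
    ∑ a ∈ A.filter (fun a => φ (L a) = m), ψ (γ a) * uPow u' (L a - m) with hγ'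
  -- `γ'_{L a₀} ≡ ψ(γ_{a₀}) (mod (u'))` whenever `L a₀` is minimal
  have hcong : ∀ a₀ ∈ A, L a₀ ∈ M → γ' (L a₀) - ψ (γ a₀) ∈ Ideal.span (Set.range u') := by
    intro a₀ ha₀ hm
    have ha₀f : a₀ ∈ A.filter (fun a => φ (L a) = L a₀) :=
      Finset.mem_filter.mpr ⟨ha₀, hφid _ hm⟩
    have hsplit : γ' (L a₀) = ψ (γ a₀) +
        ∑ a ∈ (A.filter (fun a => φ (L a) = L a₀)).erase a₀, ψ (γ a) * uPow u' (L a - L a₀) := by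
      have h0 : L a₀ - L a₀ = 0 := funext fun l => Nat.sub_self _
      simp only [hγ']
      rw [← Finset.add_sum_erase _ _ ha₀f, h0, uPow_zero, mul_one]
    rw [hsplit, add_sub_cancel_left]
    refine Submodule.sum_mem _ fun a ha => ?_
    obtain ⟨hne, ha'⟩ := Finset.mem_erase.mp ha
    obtain ⟨haA, hφa⟩ := Finset.mem_filter.mp ha'
    -- `L a₀ = φ (L a) ≤ L a` and `L a ≠ L a₀`
    have hle : L a₀ ≤ L a := hφa ▸ hφle (L a) (Finset.mem_image_of_mem L haA)
    have hneL : L a ≠ L a₀ := fun h => hne (hLinj h)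
    obtain ⟨l, hl⟩ : ∃ l, ¬ L a l ≤ L a₀ l := by
      by_contra hcon
      push Not at hcon
      exact hneL (le_antisymm hcon hle)
    obtain ⟨c, hc⟩ := dvd_uPow_of_pos u' (b := L a - L a₀) (j := l) (by simp only [Pi.sub_apply]; omega)
    rw [hc, ← mul_assoc]
    exact Ideal.mul_mem_right _ _ (Ideal.mul_mem_left _ _ (Ideal.subset_span (Set.mem_range_self l)))
  refine ⟨M, γ', hanti, Finset.filter_subset _ _, fun c hc => ⟨φ c, hφM c hc, hφle c hc⟩,
    fun m hm hmem => ?_, ?_, hcong⟩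
  · obtain ⟨hmC, -⟩ := Finset.mem_filter.mp hm
    obtain ⟨a₀, ha₀, rfl⟩ := Finset.mem_image.mp hmC
    apply hγ a₀ ha₀ (hψ _ ?_)
    have : ψ (γ a₀) = γ' (L a₀) - (γ' (L a₀) - ψ (γ a₀)) := by ring
    rw [this]
    exact sub_mem hmem (hcong a₀ ha₀ hm)
  · -- regrouping the image expansion along the fibres of `a ↦ φ (L a)`
    rw [hf, map_sum]
    simp only [map_mul, hL]
    rw [← Finset.sum_fiberwise_of_maps_to (s := A) (t := M) (g := fun a => φ (L a))
      (fun a ha => hφM _ (Finset.mem_image_of_mem L ha))]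
    refine Finset.sum_congr rfl fun m hm => ?_
    rw [hγ', Finset.sum_mul]
    refine Finset.sum_congr rfl fun a ha => ?_
    obtain ⟨haA, hφa⟩ := Finset.mem_filter.mp ha
    have hle : m ≤ L a := hφa ▸ hφle (L a) (Finset.mem_image_of_mem L haA)
    have heq : L a - m + m = L a := funext fun l => Nat.sub_add_cancel (hle l)
    rw [mul_assoc, ← uPow_add, heq]

/-- `exists_expansion_map_of_expansion'` without the coefficient congruence.
[cite: CossartPiltant2019, Prop. 2.6, proof (arXiv v1 p. 13)] -/
theorem exists_expansion_map_of_expansion {S' : Type*} [CommRing S'] {N' : ℕ} (ψ : S →+* S')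
    (u : Fin N → S) (u' : Fin N' → S') (L : (Fin N → ℕ) → (Fin N' → ℕ))
    (hLinj : Function.Injective L) (hL : ∀ a, ψ (uPow u a) = uPow u' (L a))
    (hψ : ∀ γ : S, ψ γ ∈ Ideal.span (Set.range u') → γ ∈ Ideal.span (Set.range u))
    {f : S} {A : Finset (Fin N → ℕ)} {γ : (Fin N → ℕ) → S}
    (hγ : ∀ a ∈ A, γ a ∉ Ideal.span (Set.range u)) (hf : f = ∑ a ∈ A, γ a * uPow u a) :
    ∃ (M : Finset (Fin N' → ℕ)) (γ' : (Fin N' → ℕ) → S'),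
      IsAntichain (· ≤ ·) (↑M : Set (Fin N' → ℕ)) ∧ M ⊆ A.image L ∧
      (∀ c ∈ A.image L, ∃ m ∈ M, m ≤ c) ∧
      (∀ m ∈ M, γ' m ∉ Ideal.span (Set.range u')) ∧
      ψ f = ∑ m ∈ M, γ' m * uPow u' m := by
  obtain ⟨M, γ', h1, h2, h3, h4, h5, -⟩ :=
    exists_expansion_map_of_expansion' ψ u u' L hLinj hL hψ hγ hf
  exact ⟨M, γ', h1, h2, h3, h4, h5⟩

/-- **`𝐒(ψ f)` is the antichain of minimal elements of `L(𝐒(f))`** under a monomial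
substitution as in `exists_expansion_map_of_expansion`, when `u'` satisfies (H) in `S'`.
[cite: CossartPiltant2019, Prop. 2.6, proof (arXiv v1 p. 13)] -/
theorem exists_minimal_map_of_expansion {S' : Type*} [CommRing S'] {N' : ℕ} (ψ : S →+* S')
    (u : Fin N → S) (u' : Fin N' → S')
    (H' : ∀ (i : Fin N') (T : Finset (Fin N')), i ∉ T →
      ∀ y, u' i * y ∈ Ideal.span (u' '' ↑T) → y ∈ Ideal.span (u' '' ↑T))
    (L : (Fin N → ℕ) → (Fin N' → ℕ))
    (hLinj : Function.Injective L) (hL : ∀ a, ψ (uPow u a) = uPow u' (L a))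
    (hψ : ∀ γ : S, ψ γ ∈ Ideal.span (Set.range u') → γ ∈ Ideal.span (Set.range u))
    {f : S} {A : Finset (Fin N → ℕ)} {γ : (Fin N → ℕ) → S}
    (hγ : ∀ a ∈ A, γ a ∉ Ideal.span (Set.range u)) (hf : f = ∑ a ∈ A, γ a * uPow u a) :
    ∃ M : Finset (Fin N' → ℕ), IsAntichain (· ≤ ·) (↑M : Set (Fin N' → ℕ)) ∧ M ⊆ A.image L ∧
      (∀ c ∈ A.image L, ∃ m ∈ M, m ≤ c) ∧ ψ f ∈ Ideal.span (uPow u' '' ↑M) ∧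
      ∀ B : Set (Fin N' → ℕ), ψ f ∈ Ideal.span (uPow u' '' B) → ∀ m ∈ M, ∃ b ∈ B, b ≤ m := by
  obtain ⟨M, γ', hanti, hsub, hrefine, hγ', hf'⟩ :=
    exists_expansion_map_of_expansion ψ u u' L hLinj hL hψ hγ hf
  refine ⟨M, hanti, hsub, hrefine, ?_, minimal_of_coeff_not_mem u' H' hanti hγ' hf'⟩
  rw [hf']
  exact Submodule.sum_mem _ fun m hm => Ideal.mul_mem_left _ _ (uPow_mem_span_uPow u' (Finset.mem_coe.mpr hm))

/-! ## `δ_α(h; u; X)` through the sets `𝐒(f_{i,X})` (Def. 2.2 with Prop. 2.1; Prop. 2.4, last statement) -/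

/-- **`δ_α(h; u; X) ≥ q ⟺ i q ≤ |a|_α` for all `a ∈ 𝐒(f_{i,X})`, `1 ≤ i ≤ m`** (`α ≥ 0`), given
the minimal antichains `A i = 𝐒(f_{i,X})` of the coefficients `f_{i,X} = coeff_{m-i} h`.
[cite: CossartPiltant2019, Def. 2.2 (arXiv v1 p. 10)] -/
theorem deltaGE_iff_of_minimal (u : Fin N → S) {α : Fin N → ℝ} (hα : ∀ j, 0 ≤ α j)
    {h : Polynomial S} (A : ℕ → Finset (Fin N → ℕ))
    (hA : ∀ i ∈ Finset.Icc 1 h.natDegree,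
      h.coeff (h.natDegree - i) ∈ Ideal.span (uPow u '' ↑(A i)))
    (hmin : ∀ i ∈ Finset.Icc 1 h.natDegree, ∀ B : Set (Fin N → ℕ),
      h.coeff (h.natDegree - i) ∈ Ideal.span (uPow u '' B) → ∀ a ∈ A i, ∃ b ∈ B, b ≤ a)
    {q : ℝ} :
    DeltaGE u α h q ↔ ∀ i ∈ Finset.Icc 1 h.natDegree, ∀ a ∈ A i, (i : ℝ) * q ≤ weight α a := by
  refine forall₂_congr fun i hi => ?_
  exact mem_monomialIdeal_iff_of_minimal u hα (hA i hi) (hmin i hi)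

/-- **`δ_α(h; u; X) = min {|a|_α / i : a ∈ 𝐒(f_{i,X}), 1 ≤ i ≤ m}`** (`α ≥ 0`) whenever some
`f_{i,X} ≠ 0` — Def. 2.2 made effective by Prop. 2.1; for `α = 𝟙` and minimal coordinates this is
the last statement of Prop. 2.4, `δ(y) = min {(1/i) Σ_j a_j : a ∈ 𝐒(f_{i,Z}), 1 ≤ i ≤ m}`.
[cite: CossartPiltant2019, Def. 2.2 and Prop. 2.4 (arXiv v1 pp. 10, 12)] -/
theorem delta_eq_inf'_of_minimal (u : Fin N → S) {α : Fin N → ℝ} (hα : ∀ j, 0 ≤ α j)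
    {h : Polynomial S} (A : ℕ → Finset (Fin N → ℕ))
    (hA : ∀ i ∈ Finset.Icc 1 h.natDegree,
      h.coeff (h.natDegree - i) ∈ Ideal.span (uPow u '' ↑(A i)))
    (hmin : ∀ i ∈ Finset.Icc 1 h.natDegree, ∀ B : Set (Fin N → ℕ),
      h.coeff (h.natDegree - i) ∈ Ideal.span (uPow u '' B) → ∀ a ∈ A i, ∃ b ∈ B, b ≤ a)
    (hne : ((Finset.Icc 1 h.natDegree).sigma A).Nonempty) :
    delta u α h = ((((Finset.Icc 1 h.natDegree).sigma A).inf' hne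
      (fun p => weight α p.2 / (p.1 : ℝ)) : ℝ) : EReal) := by
  have hpos : ∀ p ∈ (Finset.Icc 1 h.natDegree).sigma A, (0 : ℝ) < (p.1 : ℝ) := by
    intro p hp
    have := (Finset.mem_Icc.mp (Finset.mem_sigma.mp hp).1).1
    exact_mod_cast this
  apply le_antisymm
  · refine sSup_le fun r hr => ?_
    obtain ⟨q, hq, rfl⟩ := hr
    refine EReal.coe_le_coe_iff.mpr ((Finset.le_inf'_iff hne _).mpr fun p hp => ?_)
    rw [le_div_iff₀ (hpos p hp), mul_comm]
    obtain ⟨hi, ha⟩ := Finset.mem_sigma.mp hp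
    exact (deltaGE_iff_of_minimal u hα A hA hmin).mp hq p.1 hi p.2 ha
  · refine DeltaGE.le_delta ((deltaGE_iff_of_minimal u hα A hA hmin).mpr fun i hi a ha => ?_)
    have hp : (⟨i, a⟩ : Σ _ : ℕ, Fin N → ℕ) ∈ (Finset.Icc 1 h.natDegree).sigma A :=
      Finset.mem_sigma.mpr ⟨hi, ha⟩
    have h1 := Finset.inf'_le (fun p : Σ _ : ℕ, Fin N → ℕ => weight α p.2 / (p.1 : ℝ)) hp
    rw [le_div_iff₀ (hpos _ hp), mul_comm] at h1
    exact h1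

/-! ## Saturation: elements prime to `(u)` are non-zero-divisors modulo monomial ideals -/

/-- **Generalized key lemma**: an element `s` which is a non-zero-divisor modulo every
`(u_t : t ∈ T')` is a non-zero-divisor modulo every `(u_t : t ∈ T) + (u^b : b ∈ B)` (same
induction as `mem_of_mul_mem_sup_span_uPow`; the colon step uses (H)).  For part of a regular
system of parameters this applies to every `s ∉ (u₁, …, u_N)`, so monomial ideals are unchanged
by localization at `(u₁, …, u_N)` — the mechanism of (2.5) `Δ_S(h; u_J; X) = Δ_{S_{s^J}}(h; u_J; X)`.
[cite: CossartPiltant2019, (2.5) (arXiv v1 p. 10)] -/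
theorem mem_of_mul_mem_sup_span_uPow_of_sat (u : Fin N → S)
    (H : ∀ (i : Fin N) (T : Finset (Fin N)), i ∉ T →
      ∀ y, u i * y ∈ Ideal.span (u '' ↑T) → y ∈ Ideal.span (u '' ↑T))
    {s : S} (hs : ∀ (T : Finset (Fin N)) (y : S), s * y ∈ Ideal.span (u '' ↑T) →
      y ∈ Ideal.span (u '' ↑T))
    (T : Finset (Fin N)) (B : Finset (Fin N → ℕ)) {y : S}
    (hy : s * y ∈ Ideal.span (u '' ↑T) ⊔ Ideal.span (uPow u '' ↑B)) :
    y ∈ Ideal.span (u '' ↑T) ⊔ Ideal.span (uPow u '' ↑B) := by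
  classical
  suffices key : ∀ (D : ℕ) (T : Finset (Fin N)) (B : Finset (Fin N → ℕ)),
      ∑ b ∈ B, ∑ l ∈ Tᶜ, b l = D →
      ∀ y, s * y ∈ Ideal.span (u '' ↑T) ⊔ Ideal.span (uPow u '' ↑B) →
        y ∈ Ideal.span (u '' ↑T) ⊔ Ideal.span (uPow u '' ↑B) from
    key _ T B rfl y hy
  intro D
  induction D using Nat.strong_induction_on with
  | _ D ih =>
  intro T B hD y hy
  by_cases hex : ∃ b ∈ B, ∃ j ∉ T, 0 < b j
  swap
  · push Not at hex
    by_cases h0 : (0 : Fin N → ℕ) ∈ B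
    · have h1 : (1 : S) ∈ Ideal.span (uPow u '' ↑B) := by
        have := uPow_mem_span_uPow u (B := ↑B) (Finset.mem_coe.mpr h0)
        rwa [uPow_zero] at this
      rw [(Ideal.eq_top_iff_one _).mpr (Ideal.mem_sup_right h1)]
      trivial
    · have hle : Ideal.span (uPow u '' ↑B) ≤ Ideal.span (u '' ↑T) := by
        rw [span_uPow_le_iff]
        intro b hb
        have hb' : b ∈ B := Finset.mem_coe.mp hb
        obtain ⟨l, hl⟩ : ∃ l, b l ≠ 0 := by
          by_contra hcon
          push Not at hcon
          exact h0 ((funext hcon : b = 0) ▸ hb')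
        have hlT : l ∈ T := by
          by_contra hlT
          exact hl (Nat.le_zero.mp (hex b hb' l hlT))
        obtain ⟨c, hc⟩ := dvd_uPow_of_pos u (Nat.pos_of_ne_zero hl)
        rw [hc]
        exact Ideal.mul_mem_right _ _ (Ideal.subset_span ⟨l, Finset.mem_coe.mpr hlT, rfl⟩)
      have heq : Ideal.span (u '' ↑T) ⊔ Ideal.span (uPow u '' ↑B) = Ideal.span (u '' ↑T) :=
        sup_eq_left.mpr hle
      rw [heq] at hy ⊢
      exact hs T y hy
  · obtain ⟨b₀, hb₀, j, hjT, hj⟩ := hex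
    set φ : (Fin N → ℕ) → (Fin N → ℕ) := fun b => if 0 < b j then b - Pi.single j 1 else b
      with hφ
    have m2 : ∑ b ∈ B.filter (fun b => b j = 0), ∑ l ∈ (insert j T)ᶜ, b l < D :=
      hD ▸ sum_filter_sum_compl_insert_lt T B hjT hb₀ hj
    have m3 : ∑ b ∈ B.image φ, ∑ l ∈ Tᶜ, b l < D :=
      hD ▸ sum_image_lower_sum_compl_lt T B hjT hb₀ hj
    -- Step A: reduce modulo `u_j`
    have hyA : y ∈ Ideal.span (u '' ↑(insert j T)) ⊔
        Ideal.span (uPow u '' ↑(B.filter (fun b => b j = 0))) :=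
      ih _ m2 (insert j T) (B.filter (fun b => b j = 0)) rfl y
        (sup_span_uPow_le_insert_filter u T B j hy)
    have hyA' : y ∈ Ideal.span {u j} ⊔ (Ideal.span (u '' ↑T) ⊔
        Ideal.span (uPow u '' ↑(B.filter (fun b => b j = 0)))) := by
      rwa [Finset.coe_insert, Set.image_insert_eq, Ideal.span_insert, sup_assoc] at hyA
    obtain ⟨v, hv, y'', hy'', hvy⟩ := Submodule.mem_sup.mp hyA'
    obtain ⟨y', rfl⟩ := Ideal.mem_span_singleton'.mp hv
    have hy''B : y'' ∈ Ideal.span (u '' ↑T) ⊔ Ideal.span (uPow u '' ↑B) := by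
      have hle : Ideal.span (u '' ↑T) ⊔ Ideal.span (uPow u '' ↑(B.filter (fun b => b j = 0))) ≤
          Ideal.span (u '' ↑T) ⊔ Ideal.span (uPow u '' ↑B) := by
        refine sup_le_sup_left (Ideal.span_mono (Set.image_mono ?_)) _
        exact fun b hb => Finset.mem_coe.mpr (Finset.mem_filter.mp (Finset.mem_coe.mp hb)).1
      exact hle hy''
    -- Step B: colon by `u_j` (this is where (H) enters) and induction for the lowered family
    have hjz : u j * (s * y') ∈ Ideal.span (u '' ↑T) ⊔ Ideal.span (uPow u '' ↑B) := by
      have : u j * (s * y') = s * y - s * y'' := by rw [← hvy]; ring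
      rw [this]
      exact sub_mem hy (Ideal.mul_mem_left _ _ hy''B)
    have hz : s * y' ∈ Ideal.span (u '' ↑T) ⊔ Ideal.span (uPow u '' ↑(B.image φ)) :=
      (mul_mem_sup_span_uPow_iff u H T B hjT).mp hjz
    have hy' : y' ∈ Ideal.span (u '' ↑T) ⊔ Ideal.span (uPow u '' ↑(B.image φ)) :=
      ih _ m3 T (B.image φ) rfl y' hz
    rw [← hvy]
    exact add_mem (by rw [mul_comm]; exact mul_mem_sup_span_uPow_of_mem_lower u T B j hy') hy''B

/-- Saturation, `T = ∅` and general sets of exponents: `s y ∈ (u^b : b ∈ B) ⇒ y ∈ (u^b : b ∈ B)`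
for `s` a non-zero-divisor modulo every `(u_t : t ∈ T')`. [cite: CossartPiltant2019, (2.5) (arXiv v1 p. 10)] -/
theorem mem_of_mul_mem_span_uPow_of_sat (u : Fin N → S)
    (H : ∀ (i : Fin N) (T : Finset (Fin N)), i ∉ T →
      ∀ y, u i * y ∈ Ideal.span (u '' ↑T) → y ∈ Ideal.span (u '' ↑T))
    {s : S} (hs : ∀ (T : Finset (Fin N)) (y : S), s * y ∈ Ideal.span (u '' ↑T) →
      y ∈ Ideal.span (u '' ↑T))
    (B : Set (Fin N → ℕ)) {y : S} (hy : s * y ∈ Ideal.span (uPow u '' B)) :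
    y ∈ Ideal.span (uPow u '' B) := by
  obtain ⟨B₀, -, -, heq⟩ := exists_finset_span_uPow_eq u B
  rw [heq] at hy ⊢
  have h := mem_of_mul_mem_sup_span_uPow_of_sat u H hs ∅ B₀ (y := y)
  rw [span_image_coe_empty_sup] at h
  exact h hy

/-! ## Invariance under localization at a prime containing `(u)` ((2.5)) -/

section Localization

variable {Sₚ : Type*} [CommRing Sₚ] [Algebra S Sₚ] (P : Ideal S) [P.IsPrime]
  [IsLocalization.AtPrime Sₚ P]

/-- `u^x` maps to `(φ ∘ u)^x` under a ring homomorphism. [folklore] -/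
theorem map_uPow {S' : Type*} [CommRing S'] (φ : S →+* S') (u : Fin N → S) (x : Fin N → ℕ) :
    φ (uPow u x) = uPow (φ ∘ u) x := by
  simp [uPow, map_prod, map_pow]

/-- The monomial ideal of `φ ∘ u` is the extension of the monomial ideal of `u`. [folklore] -/
theorem span_uPow_comp_eq_map {S' : Type*} [CommRing S'] (φ : S →+* S') (u : Fin N → S)
    (B : Set (Fin N → ℕ)) :
    Ideal.span (uPow (φ ∘ u) '' B) = (Ideal.span (uPow u '' B)).map φ := by
  rw [Ideal.map_span, ← Set.image_comp]
  congr 1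
  ext m
  simp only [Set.mem_image, Function.comp_apply, map_uPow]

/-- An ideal saturated with respect to the complement of a prime `P` is the contraction of its
extension to `S_P`. [folklore] -/
theorem comap_map_eq_of_forall_mul_mem {I : Ideal S}
    (hI : ∀ s ∉ P, ∀ y, s * y ∈ I → y ∈ I) :
    (I.map (algebraMap S Sₚ)).comap (algebraMap S Sₚ) = I := by
  refine le_antisymm (fun y hy => ?_) Ideal.le_comap_map
  rw [Ideal.mem_comap, IsLocalization.mem_map_algebraMap_iff P.primeCompl] at hy
  obtain ⟨⟨⟨i, hi⟩, ⟨m, hm⟩⟩, h⟩ := hy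
  simp only at h
  rw [← map_mul] at h
  obtain ⟨⟨c, hc⟩, hc'⟩ := (IsLocalization.eq_iff_exists P.primeCompl Sₚ).mp h
  simp only at hc'
  -- `c (y m) = c i ∈ I` with `c, m ∉ P`
  have h1 : c * m * y ∈ I := by
    have : c * m * y = c * (y * m) := by ring
    rw [this, hc']
    exact Ideal.mul_mem_left _ _ hi
  have h2 : m * y ∈ I := hI c hc _ (by rwa [mul_assoc] at h1)
  exact hI m hm _ h2

/-- **Monomial ideals are unchanged by localization at a prime `P ⊇ (u)`**: for `f ∈ S`,
`f ∈ (u^b : b ∈ B) S_P ⟺ f ∈ (u^b : b ∈ B)`, provided (H) holds and every `s ∉ P` is a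
non-zero-divisor modulo every `(u_t : t ∈ T)`. [cite: CossartPiltant2019, (2.5) (arXiv v1 p. 10)] -/
theorem algebraMap_mem_span_uPow_iff (u : Fin N → S)
    (H : ∀ (i : Fin N) (T : Finset (Fin N)), i ∉ T →
      ∀ y, u i * y ∈ Ideal.span (u '' ↑T) → y ∈ Ideal.span (u '' ↑T))
    (hP : ∀ s ∉ P, ∀ (T : Finset (Fin N)) (y : S), s * y ∈ Ideal.span (u '' ↑T) →
      y ∈ Ideal.span (u '' ↑T))
    (B : Set (Fin N → ℕ)) (f : S) :
    algebraMap S Sₚ f ∈ Ideal.span (uPow (algebraMap S Sₚ ∘ u) '' B) ↔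
      f ∈ Ideal.span (uPow u '' B) := by
  rw [span_uPow_comp_eq_map, ← Ideal.mem_comap,
    comap_map_eq_of_forall_mul_mem P fun s hs y hy => mem_of_mul_mem_span_uPow_of_sat u H (hP s hs) B hy]

/-- `I_α(a)` for `φ ∘ u` is the extension of `I_α(a)` for `u`. [folklore] -/
theorem monomialIdeal_comp_eq_map {S' : Type*} [CommRing S'] (φ : S →+* S') (u : Fin N → S)
    (α : Fin N → ℝ) (a : ℝ) :
    monomialIdeal (φ ∘ u) α a = (monomialIdeal u α a).map φ := by
  rw [monomialIdeal_eq_span_image, monomialIdeal_eq_span_image, span_uPow_comp_eq_map]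

/-- **(2.5): `δ_α(h; u; X) ≥ q` is unchanged by localization at a prime `P ⊇ (u)`**, for `h` whose
degree is preserved (e.g. `h` monic), under the hypotheses of `algebraMap_mem_span_uPow_iff`.
[cite: CossartPiltant2019, (2.5) (arXiv v1 p. 10)] -/
theorem deltaGE_map_iff (u : Fin N → S)
    (H : ∀ (i : Fin N) (T : Finset (Fin N)), i ∉ T →
      ∀ y, u i * y ∈ Ideal.span (u '' ↑T) → y ∈ Ideal.span (u '' ↑T))
    (hP : ∀ s ∉ P, ∀ (T : Finset (Fin N)) (y : S), s * y ∈ Ideal.span (u '' ↑T) →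
      y ∈ Ideal.span (u '' ↑T))
    (α : Fin N → ℝ) {h : Polynomial S}
    (hdeg : (h.map (algebraMap S Sₚ)).natDegree = h.natDegree) (q : ℝ) :
    DeltaGE (algebraMap S Sₚ ∘ u) α (h.map (algebraMap S Sₚ)) q ↔ DeltaGE u α h q := by
  unfold DeltaGE
  rw [hdeg]
  refine forall₂_congr fun i _ => ?_
  rw [Polynomial.coeff_map, monomialIdeal_eq_span_image, monomialIdeal_eq_span_image]
  exact algebraMap_mem_span_uPow_iff P u H hP _ _

end Localization

/-! ## Invariance under faithfully flat base change, e.g. completion ((2.4)) -/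

section FaithfullyFlat

variable {S' : Type*} [CommRing S'] [Algebra S S'] [Module.FaithfullyFlat S S']

/-- **Monomial membership is unchanged by a faithfully flat base change** `S → S'` (e.g. the
completion `Ŝ`, or a regular local base change `S ⊆ S̃`): `I S' ∩ S = I`.
[cite: CossartPiltant2019, (2.4) (arXiv v1 p. 10)] -/
theorem algebraMap_mem_span_uPow_iff_of_faithfullyFlat (u : Fin N → S) (B : Set (Fin N → ℕ))
    (f : S) :
    algebraMap S S' f ∈ Ideal.span (uPow (algebraMap S S' ∘ u) '' B) ↔
      f ∈ Ideal.span (uPow u '' B) := by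
  rw [span_uPow_comp_eq_map, ← Ideal.mem_comap, Ideal.comap_map_eq_self_of_faithfullyFlat]

/-- **(2.4): `δ_α(h; u; X) ≥ q` is unchanged by a faithfully flat base change** (for `h` whose
degree is preserved, e.g. `h` monic). [cite: CossartPiltant2019, (2.4) (arXiv v1 p. 10)] -/
theorem deltaGE_map_iff_of_faithfullyFlat (u : Fin N → S) (α : Fin N → ℝ) {h : Polynomial S}
    (hdeg : (h.map (algebraMap S S')).natDegree = h.natDegree) (q : ℝ) :
    DeltaGE (algebraMap S S' ∘ u) α (h.map (algebraMap S S')) q ↔ DeltaGE u α h q := by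
  unfold DeltaGE
  rw [hdeg]
  refine forall₂_congr fun i _ => ?_
  rw [Polynomial.coeff_map, monomialIdeal_eq_span_image, monomialIdeal_eq_span_image]
  exact algebraMap_mem_span_uPow_iff_of_faithfullyFlat u _ _

end FaithfullyFlat

/-- **(2.4) for the `𝔪`-adic completion `Ŝ` of a Noetherian local ring**:
`Δ_S(h; u; X) = Δ_Ŝ(h; u; X)` in the form "`δ_α ≥ q` over `S` iff over `Ŝ`" (`h` monic; `S → Ŝ`
is flat and local, hence faithfully flat). [cite: CossartPiltant2019, (2.4) (arXiv v1 p. 10)] -/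
theorem deltaGE_map_adicCompletion_iff [IsNoetherianRing S] [IsLocalRing S] (u : Fin N → S)
    (α : Fin N → ℝ) {h : Polynomial S} (hh : h.Monic) (q : ℝ) :
    DeltaGE (algebraMap S (AdicCompletion (maximalIdeal S) S) ∘ u) α
        (h.map (algebraMap S (AdicCompletion (maximalIdeal S) S))) q ↔ DeltaGE u α h q := by
  haveI : Module.FaithfullyFlat S (AdicCompletion (maximalIdeal S) S) :=
    Module.FaithfullyFlat.of_flat_of_isLocalHom
  exact deltaGE_map_iff_of_faithfullyFlat u α (hh.natDegree_map _) q

end Literature.AlgebraicGeometry.Resolution.CossartPiltant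

/-! ## Regular systems of parameters satisfy (H) -/

namespace Literature.AlgebraicGeometry.Resolution

open CossartPiltant

universe u

variable {R : Type u} [CommRing R]

/-- **(H) for a regular system of parameters** `x₁, …, x_d` of a regular local ring: `x_i` is a
non-zero-divisor modulo `(x_t : t ∈ T)` for `i ∉ T` (the ideal is prime and does not contain
`x_i`; Matsumura Thms. 14.2, 14.3, 17.8). [cite: Matsumura1987, Thm. 17.8] -/
theorem mem_span_image_of_mul_mem_rsop [IsRegularLocalRing R] {d : ℕ}
    (hd : (maximalIdeal R).spanFinrank = d) (x : Fin d → R)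
    (hx : Ideal.span (Set.range x) = maximalIdeal R) (i : Fin d) (T : Finset (Fin d))
    (hiT : i ∉ T) (y : R) (hy : x i * y ∈ Ideal.span (x '' ↑T)) : y ∈ Ideal.span (x '' ↑T) :=
  ((isPrime_span_image hd x hx T).mem_or_mem hy).resolve_left
    (not_mem_span_image_of_not_mem hd x hx (fun h => hiT (Finset.mem_coe.mp h)))

namespace IsRsopPart

variable [IsLocalRing R] {n : ℕ} {z : Fin n → R}

/-- **(H) for part of a regular system of parameters.** [cite: Matsumura1987, Thm. 17.8] -/
theorem mem_span_image_of_mul_mem (hz : IsRsopPart z) (i : Fin n) (T : Finset (Fin n))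
    (hiT : i ∉ T) (y : R) (hy : z i * y ∈ Ideal.span (z '' ↑T)) : y ∈ Ideal.span (z '' ↑T) := by
  classical
  have hP : (Ideal.span (z '' ↑T)).IsPrime := by
    let e := T.orderEmbOfFin rfl
    have h := (hz.comp e e.injective).isPrime_span_range
    rwa [Set.range_comp, Finset.range_orderEmbOfFin] at h
  exact (hP.mem_or_mem hy).resolve_left (hz.not_mem_span_image fun h => hiT (Finset.mem_coe.mp h))

/-- **Monomial membership** for part of a regular system of parameters:
`z^a ∈ (z^b : b ∈ B) ⟺ ∃ b ∈ B, b ≤ a`. [folklore] -/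
theorem uPow_mem_span_uPow_iff (hz : IsRsopPart z) (B : Set (Fin n → ℕ)) (a : Fin n → ℕ) :
    uPow z a ∈ Ideal.span (uPow z '' B) ↔ ∃ b ∈ B, b ≤ a :=
  CossartPiltant.uPow_mem_span_uPow_iff z hz.mem_span_image_of_mul_mem hz.span_range_ne_top B a

/-- **Colon by a monomial** for part of a regular system of parameters. [folklore] -/
theorem uPow_mul_mem_span_uPow_iff (hz : IsRsopPart z) (B : Set (Fin n → ℕ)) (a : Fin n → ℕ)
    {y : R} : uPow z a * y ∈ Ideal.span (uPow z '' B) ↔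
      y ∈ Ideal.span (uPow z '' ((fun b => b - a) '' B)) :=
  CossartPiltant.uPow_mul_mem_span_uPow_iff z hz.mem_span_image_of_mul_mem B a

/-- **Intersection of monomial ideals** for part of a regular system of parameters. [folklore] -/
theorem span_uPow_inf_span_uPow (hz : IsRsopPart z) (B C : Set (Fin n → ℕ)) :
    Ideal.span (uPow z '' B) ⊓ Ideal.span (uPow z '' C) =
      Ideal.span (uPow z '' Set.image2 (· ⊔ ·) B C) :=
  CossartPiltant.span_uPow_inf_span_uPow z hz.mem_span_image_of_mul_mem B C

/-- **Cossart–Piltant 2019, Prop. 2.1** for part of a regular system of parameters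
`z = (u_j)_{j ∈ J}` of a regular local ring: existence of the finite antichain `𝐒^J(f)` with
`f ∈ (u^a : a ∈ 𝐒^J(f))` minimal among monomial ideals containing `f`; uniqueness is
`CossartPiltant.antichain_unique_of_forall_exists_le`, and property (ii) (coefficients
`γ(f, a) ∉ I_J = (u_j : j ∈ J)`) is `CossartPiltant.coeff_not_mem_of_minimal`.
[cite: CossartPiltant2019, Prop. 2.1 (arXiv v1 p. 10)] -/
theorem exists_minimal_span_uPow (hz : IsRsopPart z) (f : R) :
    ∃ A : Finset (Fin n → ℕ), IsAntichain (· ≤ ·) (↑A : Set (Fin n → ℕ)) ∧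
      f ∈ Ideal.span (uPow z '' ↑A) ∧
      ∀ B : Set (Fin n → ℕ), f ∈ Ideal.span (uPow z '' B) → ∀ a ∈ A, ∃ b ∈ B, b ≤ a := by
  haveI := hz.isRegularLocalRing
  exact CossartPiltant.exists_minimal_span_uPow z hz.mem_span_image_of_mul_mem hz.mem_maximalIdeal f

/-- For part of a regular system of parameters, every `s ∉ (z₁, …, z_n)` is a non-zero-divisor
modulo every `(z_t : t ∈ T)` (the ideal is prime and contained in `(z)`).
[cite: Matsumura1987, Thm. 17.8] -/
theorem mem_span_image_of_mul_mem_of_not_mem (hz : IsRsopPart z) {s : R}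
    (hs : s ∉ Ideal.span (Set.range z)) (T : Finset (Fin n)) (y : R)
    (hy : s * y ∈ Ideal.span (z '' ↑T)) : y ∈ Ideal.span (z '' ↑T) := by
  classical
  have hP : (Ideal.span (z '' ↑T)).IsPrime := by
    let e := T.orderEmbOfFin rfl
    have h := (hz.comp e e.injective).isPrime_span_range
    rwa [Set.range_comp, Finset.range_orderEmbOfFin] at h
  refine (hP.mem_or_mem hy).resolve_left fun h => hs ?_
  exact Ideal.span_mono (Set.image_subset_range _ _) h

/-- **Monomial ideals in part of a regular system of parameters are saturated with respect to
`S ∖ (z)`**: `s ∉ (z)`, `s y ∈ (z^b : b ∈ B) ⇒ y ∈ (z^b : b ∈ B)`.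
[cite: CossartPiltant2019, (2.5) (arXiv v1 p. 10)] -/
theorem mem_of_mul_mem_span_uPow (hz : IsRsopPart z) {s : R} (hs : s ∉ Ideal.span (Set.range z))
    (B : Set (Fin n → ℕ)) {y : R} (hy : s * y ∈ Ideal.span (uPow z '' B)) :
    y ∈ Ideal.span (uPow z '' B) :=
  CossartPiltant.mem_of_mul_mem_span_uPow_of_sat z hz.mem_span_image_of_mul_mem
    (hz.mem_span_image_of_mul_mem_of_not_mem hs) B hy

/-- **(2.5) for part of a regular system of parameters**: monomial membership is unchanged by
localization at any prime `P ⊇ (z)` (e.g. `P = s^J = (u_j : j ∈ J)` itself).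
[cite: CossartPiltant2019, (2.5) (arXiv v1 p. 10)] -/
theorem algebraMap_mem_span_uPow_iff (hz : IsRsopPart z) {Rₚ : Type*} [CommRing Rₚ] [Algebra R Rₚ]
    (P : Ideal R) [P.IsPrime] [IsLocalization.AtPrime Rₚ P] (hP : Ideal.span (Set.range z) ≤ P)
    (B : Set (Fin n → ℕ)) (f : R) :
    algebraMap R Rₚ f ∈ Ideal.span (uPow (algebraMap R Rₚ ∘ z) '' B) ↔
      f ∈ Ideal.span (uPow z '' B) :=
  CossartPiltant.algebraMap_mem_span_uPow_iff P z hz.mem_span_image_of_mul_mem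
    (fun _ hs => hz.mem_span_image_of_mul_mem_of_not_mem fun h => hs (hP h)) B f

/-- **(2.5): `δ_α(h; z; X) ≥ q` over `R` iff over `R_P`** (`P ⊇ (z)` prime, `h` monic).
[cite: CossartPiltant2019, (2.5) (arXiv v1 p. 10)] -/
theorem deltaGE_map_iff (hz : IsRsopPart z) {Rₚ : Type*} [CommRing Rₚ] [Algebra R Rₚ]
    (P : Ideal R) [P.IsPrime] [IsLocalization.AtPrime Rₚ P] (hP : Ideal.span (Set.range z) ≤ P)
    (α : Fin n → ℝ) {h : Polynomial R} (hh : h.Monic) (q : ℝ) :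
    DeltaGE (algebraMap R Rₚ ∘ z) α (h.map (algebraMap R Rₚ)) q ↔ DeltaGE z α h q := by
  haveI := hz.isRegularLocalRing
  haveI : Nontrivial Rₚ := IsLocalization.AtPrime.nontrivial Rₚ P
  exact CossartPiltant.deltaGE_map_iff P z hz.mem_span_image_of_mul_mem
    (fun _ hs => hz.mem_span_image_of_mul_mem_of_not_mem fun h => hs (hP h)) α
    (hh.natDegree_map _) q

end IsRsopPart

end Literature.AlgebraicGeometry.Resolution
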